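import Literature.Geometry.Riemannian.EigenvaluePinchingSphereProofs
import Literature.Geometry.Riemannian.KarpukhinSternHarmonicMapsProofs
import HarnessLib

/-!
# Eigenvalue pinching `λₙ ≤ n + ε ⇒ M ≅ Sⁿ` (Aubry 2005) — Lemme 11: the Moser iteration (i) and almost-orthonormality (ii)

Second proofs file of the named fact `aubry_diffeomorph_sphere_of_eigenvalue_pinching`
(`EigenvaluePinchingSphere.lean`; E. Aubry, *Pincement sur le spectre et le volume en courbure de
Ricci positive*, Ann. Sci. ÉNS (4) 38 (2005) 387–405, Théorème 1), continuing
`EigenvaluePinchingSphereProofs.lean` (Part A: the assembly from Cheeger–Colding + volume pinching;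
Part B: the `L²`-layer of §2). This file PROVES the `L^∞`-layer of §2 — **Lemme 11 (i)** (and its consequence **Lemme 11 (ii)**, Part D)
(p. 393): "`‖Σ αᵢ Sᵢ‖_∞ ≤ (1 + C(n)√ε) ‖Σ αᵢ Sᵢ‖₂` pour tout `(αᵢ) ∈ ℝᵏ`" — by the printed Moser
iteration (p. 394), in the language of functions (`S_F = ∇F + F e`, `|S_F|² = |∇F|² + F²`,
`|D^E S_F|² = |Hess F + F g|²`), with the one external input of the printed proof, the Sobolev
inequality "`‖f‖²_{2n/(n−2)} ≤ C(n)‖df‖₂² + ‖f‖₂²` donnée par [14]" (S. Ilias, Ann. Inst. Fourier 33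
(1983), under `Ric ≥ n − 1`), taken as an explicit HYPOTHESIS `hSob` with constants `(A, 1)` and
any exponent `ν > 1` (the tree has the qualitative Sobolev inequality of a closed manifold,
`exists_sobolev_const`, whose constant in front of `‖f‖₂` is not `1`; Ilias' `n`-uniform form is
not yet formalised). No definitions and no named facts are introduced.

## Contents (everything proved)

* Part C0 (fibre linear algebra, any pseudo-Riemannian bundle metric): `♯` and `g⁻¹` in an
  orthogonal frame (`sharp_eq_sum_of_isOrthoᵢ`, `innerDual_eq_sum_of_isOrthoᵢ`,
  `val_self_eq_sum_of_isOrthoᵢ`), Cauchy–Schwarz on a fibre (`val_sq_le_val_mul_val`,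
  `innerDual_sq_le_mul`), the operator/Hilbert–Schmidt bound
  `g⁻¹(T(v,·),T(v,·)) ≤ |T|²_g g(v,v)` (`innerDual_apply_le_normSq_mul`) and Cauchy–Schwarz in
  Ruh's bundle `E = TM ⊕ ℝe` (`sq_innerDual_sub_mul_le`).
* Part C1 (pointwise, any model space): `d|∇F|²(v) = 2 Hess F(v, ∇F)` (`mvfderiv_gradSq_apply`, the
  coordinate identity `MetricCoord.IsMetricOn.fderiv_gradSqAt` read through the chart),
  `dQ = 2T(∇F,·)` and **Kato's inequality** `|dQ|² ≤ 4|T|²Q` for `Q = |S_F|²`, `T = Hess F + Fg`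
  (`gradSq_gradSq_add_sq_le`), the **Bochner formula for `|S_F|²`**
  (`dalembertian_gradSq_add_sq_eq`, from `dalembertian_gradSq_eq`), and the **Kato subsolution
  inequality** `−Δ √(|S_F|²+δ²) ≤ |S_w|`, `w = ΔF + mF`, under `Ric ≥ m − 1`
  (`neg_dalembertian_sqrt_le`; Aubry p. 394, first display, for an arbitrary smooth `F`).
* Part C2 (closed manifold): the energy identity `∫|∇(u^p)|² = −(p²/(2p−1))∫u^{2p−1}Δu`
  (`integral_gradSq_rpow_eq`, Green's identity) and the energy inequality
  `∫|∇(u_δ^p)|² ≤ (p²/(2p−1))∫|S_w| u_δ^{2p−1}` (`integral_gradSq_rpow_sqrt_le`; second display).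
* Part C3: normalised Hölder (`normalized_holder`), the limit `δ → 0` by dominated convergence
  (`tendsto_integral_add_sq_rpow`) and **one Moser step** (`aubry_moser_step`; third display).
* Part C4: the span of pinched eigenfunctions — `Δ(Σαᵢfᵢ) + mΣαᵢfᵢ = Σ(m−μᵢ)αᵢfᵢ`
  (`dalembertian_linComb_add_eq`, Lemme 8 in function form), the Gram identity
  `⨍|S_α|² = (Vol)⁻¹Σαᵢ²(μᵢ+1)` (`integral_gradSq_add_sq_linComb`), the coefficient estimate
  `‖S_β‖₂ ≤ ε‖S_α‖₂` (`sum_pinched_coeff_le`), the **iteration**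
  `‖S_α‖_{2νʲ} ≤ ∏_{i<j}(1 + A√ε νⁱ/√(2νⁱ−1))^{1/νⁱ} ‖S_α‖₂` (`aubry_moser_iterate`) and the bound of
  the product by `exp(A√ε/(1 − ν^{−1/2}))` (`moser_product_le`, "concavité de la fonction log").
* Part C5: the `L^∞` endpoint (`le_of_normalized_moments_le`, the Riemannian measure charges open
  sets) and **Lemme 11 (i)**: `aubry_lemma11_i` (general closed `(N, h)` modelled on `ℝᵐ`) and
  `aubry_lemma11_i_of_sobolev` (in the binders of the named fact, where `0 < μᵢ ≤ n + ε` gives the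
  two-sided pinching `n ≤ μᵢ` by Lichnerowicz, `aubry_eigenfunction_estimates`).
* Part D: **Lemme 11 (ii)** — the Chebyshev step in abstract form
  (`aubry_chebyshev_almostOrthonormal`: pointwise Gram functions with normalised `L²`-norms and the
  `L^∞` bound of (i) are `δᵢⱼ`-close off a set of small measure, pp. 394–395), the Gram quadratic
  form `|S_β(x)|² = Σ βₐβ_b ⟨Sₐ(x), S_b(x)⟩` (`gradSq_add_sq_linComb_eq_sum`) and
  `aubry_lemma11_ii` for the `L²`-normalised sections `S̃ᵢ = √(Vol/(μᵢ+1)) Sᵢ` of the pinched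
  eigenfunctions (modulo `hSob`, with a free threshold `η > 0`; Aubry takes `η = ε^{1/4}`).

What remains of the printed proof of Théorème 1 after this file: Ilias' Sobolev inequality
(hypothesis `hSob`), Prop. 12 (Lemme 13–15: Bishop–Gromov on the manifold, the degree of the
eigenmap `Φ`, the orientation cover), Prop. 19 (Lemme 16–18), and Cheeger–Colding's theorem
(`CheegerColding1997_thmA110`, undischarged).

## References

* E. Aubry, *Pincement sur le spectre et le volume en courbure de Ricci positive*, Ann. Sci.
  École Norm. Sup. (4) 38 (2005) 387–405: §2, Lemme 8 (p. 391), Lemme 11 and its proof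
  (pp. 393–395). [Aubry2005]
* S. Ilias, *Constantes explicites pour les inégalités de Sobolev sur les variétés riemanniennes
  compactes*, Ann. Inst. Fourier 33 (2) (1983) 151–165 (Aubry's reference [14]; the input `hSob`).
* B. O'Neill, *Semi-Riemannian geometry*, Academic Press 1983, Ch. 3, Prop. 3.13, pp. 60–61
  (metric compatibility; contractions in a frame). [ONeill1983]
-/

noncomputable section

open Bundle Set Function Module Filter Manifold Finset
open _root_.MeasureTheory
open scoped Manifold ContDiff Topology BigOperators

namespace Literature.Geometry.Lorentzian

/-- **Weighted Cauchy–Schwarz**: `(∑ aⱼcⱼ/wⱼ)² ≤ (∑ aⱼ²/wⱼ)(∑ cⱼ²/wⱼ)` for positive weights. [folklore] -/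
theorem sq_sum_div_le_sum_sq_div_mul {ι : Type*} (s : Finset ι) (a c w : ι → ℝ)
    (hw : ∀ j ∈ s, 0 < w j) :
    (∑ j ∈ s, a j * c j / w j) ^ 2 ≤ (∑ j ∈ s, a j ^ 2 / w j) * ∑ j ∈ s, c j ^ 2 / w j := by
  have h := Finset.sum_mul_sq_le_sq_mul_sq s (fun j ↦ a j / Real.sqrt (w j))
    (fun j ↦ c j / Real.sqrt (w j))
  have h1 : ∀ j ∈ s, a j / Real.sqrt (w j) * (c j / Real.sqrt (w j)) = a j * c j / w j := by
    intro j hj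
    rw [div_mul_div_comm, Real.mul_self_sqrt (hw j hj).le]
  have h2 : ∀ j ∈ s, (a j / Real.sqrt (w j)) ^ 2 = a j ^ 2 / w j := by
    intro j hj
    rw [div_pow, Real.sq_sqrt (hw j hj).le]
  have h3 : ∀ j ∈ s, (c j / Real.sqrt (w j)) ^ 2 = c j ^ 2 / w j := by
    intro j hj
    rw [div_pow, Real.sq_sqrt (hw j hj).le]
  rwa [Finset.sum_congr rfl h1, Finset.sum_congr rfl h2, Finset.sum_congr rfl h3] at h

namespace PseudoRiemannianMetric

section FibreAlgebra

variable
  {EB : Type*} [NormedAddCommGroup EB] [NormedSpace ℝ EB]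
  {HB : Type*} [TopologicalSpace HB] {IB : ModelWithCorners ℝ EB HB} {n : ℕ∞ω}
  {B : Type*} [TopologicalSpace B] [ChartedSpace HB B]
  {F : Type*} [NormedAddCommGroup F] [NormedSpace ℝ F] [FiniteDimensional ℝ F]
  {E : B → Type*} [TopologicalSpace (TotalSpace F E)]
  [∀ b, TopologicalSpace (E b)] [∀ b, AddCommGroup (E b)] [∀ b, Module ℝ (E b)]
  [FiberBundle F E] [VectorBundle ℝ F E]
  (g : PseudoRiemannianMetric IB n F E) (b : B)

omit [FiniteDimensional ℝ F] in
/-- **Cauchy–Schwarz on a fibre** for a Riemannian metric: `g(v, w)² ≤ g(v, v) g(w, w)`. [folklore] -/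
theorem val_sq_le_val_mul_val (hg : g.IsRiemannian) (v w : E b) :
    g.val b v w ^ 2 ≤ g.val b v v * g.val b w w := by
  by_cases hw : w = 0
  · subst hw
    simp
  have hc : 0 < g.val b w w := hg b w hw
  set t : ℝ := g.val b v w / g.val b w w with ht
  have hnn : 0 ≤ g.val b (v - t • w) (v - t • w) := by
    by_cases h0 : v - t • w = 0
    · rw [h0]; simp
    · exact (hg b _ h0).le
  have hexp : g.val b (v - t • w) (v - t • w) =
      g.val b v v - 2 * t * g.val b v w + t ^ 2 * g.val b w w := by
    simp only [map_sub, map_smul, _root_.sub_apply, FunLike.coe_smul, Pi.smul_apply, smul_eq_mul,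
      g.symm b w v]
    ring
  rw [hexp, ht] at hnn
  have key : g.val b v w ^ 2 / g.val b w w ≤ g.val b v v := by
    have : g.val b v v - 2 * (g.val b v w / g.val b w w) * g.val b v w +
        (g.val b v w / g.val b w w) ^ 2 * g.val b w w =
          g.val b v v - g.val b v w ^ 2 / g.val b w w := by
      field_simp
      ring
    linarith [this ▸ hnn]
  rwa [div_le_iff₀ hc] at key

omit [FiniteDimensional ℝ F] in
/-- `g(v, v) ≥ 0` on a fibre of a Riemannian metric. [folklore] -/
theorem val_self_nonneg' (hg : g.IsRiemannian) (v : E b) : 0 ≤ g.val b v v := by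
  by_cases hv : v = 0
  · rw [hv]; simp
  · exact (hg b v hv).le

/-- **`♯` in an orthogonal frame**: `♯β = ∑ᵢ (β(eᵢ)/g(eᵢ,eᵢ)) eᵢ`. [cite: ONeill1983, Ch. 3, p. 60] -/
theorem sharp_eq_sum_of_isOrthoᵢ {ι : Type*} [Fintype ι] [DecidableEq ι]
    (e : Basis ι ℝ (E b)) (he : (g.toBilinForm b).IsOrthoᵢ e)
    (hc : ∀ i, g.val b (e i) (e i) ≠ 0) (β : Module.Dual ℝ (E b)) :
    g.sharp b β = ∑ i, (β (e i) / g.val b (e i) (e i)) • e i := by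
  conv_lhs => rw [← e.sum_repr (g.sharp b β)]
  refine Finset.sum_congr rfl fun i _ ↦ ?_
  rw [repr_eq_div_of_isOrthoᵢ e he hc]
  simp

/-- **The inverse metric in an orthogonal frame**: `g⁻¹(α, β) = ∑ᵢ α(eᵢ) β(eᵢ) / g(eᵢ, eᵢ)`.
[cite: ONeill1983, Ch. 3, pp. 60–61] -/
theorem innerDual_eq_sum_of_isOrthoᵢ {ι : Type*} [Fintype ι] [DecidableEq ι]
    (e : Basis ι ℝ (E b)) (he : (g.toBilinForm b).IsOrthoᵢ e)
    (hc : ∀ i, g.val b (e i) (e i) ≠ 0) (α β : Module.Dual ℝ (E b)) :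
    g.innerDual b α β = ∑ i, α (e i) * β (e i) / g.val b (e i) (e i) := by
  rw [innerDual, g.sharp_eq_sum_of_isOrthoᵢ b e he hc β, map_sum]
  refine Finset.sum_congr rfl fun i _ ↦ ?_
  rw [map_smul, smul_eq_mul]
  ring

omit [FiniteDimensional ℝ F] in
/-- **Parseval in an orthogonal frame**: `g(v, v) = ∑ᵢ g(v, eᵢ)² / g(eᵢ, eᵢ)`. [folklore] -/
theorem val_self_eq_sum_of_isOrthoᵢ {ι : Type*} [Fintype ι] [DecidableEq ι]
    (e : Basis ι ℝ (E b)) (he : (g.toBilinForm b).IsOrthoᵢ e)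
    (hc : ∀ i, g.val b (e i) (e i) ≠ 0) (v : E b) :
    g.val b v v = ∑ i, g.val b v (e i) ^ 2 / g.val b (e i) (e i) := by
  have hv : ∑ i, e.repr v i • e i = v := e.sum_repr v
  calc g.val b v v = g.val b v (∑ i, e.repr v i • e i) := by rw [hv]
    _ = ∑ i, e.repr v i * g.val b v (e i) := by
        rw [map_sum]
        refine Finset.sum_congr rfl fun i _ ↦ ?_
        rw [map_smul, smul_eq_mul]
    _ = ∑ i, g.val b v (e i) ^ 2 / g.val b (e i) (e i) := by
        refine Finset.sum_congr rfl fun i _ ↦ ?_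
        rw [repr_eq_div_of_isOrthoᵢ e he hc]
        simp only [toBilinForm_apply]
        field_simp [hc i]

omit [FiniteDimensional ℝ F] in
/-- Coordinates of `T(v, ·)` in an orthogonal frame: `T(v, eᵢ) = ∑ⱼ (g(v,eⱼ)/g(eⱼ,eⱼ)) T(eⱼ, eᵢ)`. [folklore] -/
theorem bilin_apply_eq_sum_of_isOrthoᵢ {ι : Type*} [Fintype ι] [DecidableEq ι]
    (e : Basis ι ℝ (E b)) (he : (g.toBilinForm b).IsOrthoᵢ e)
    (hc : ∀ i, g.val b (e i) (e i) ≠ 0) (T : LinearMap.BilinForm ℝ (E b)) (v w : E b) :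
    T v w = ∑ j, (g.val b v (e j) / g.val b (e j) (e j)) * T (e j) w := by
  have hv : ∑ j, e.repr v j • e j = v := e.sum_repr v
  calc T v w = T (∑ j, e.repr v j • e j) w := by rw [hv]
    _ = ∑ j, (g.val b v (e j) / g.val b (e j) (e j)) * T (e j) w := by
        rw [map_sum, LinearMap.sum_apply]
        refine Finset.sum_congr rfl fun j _ ↦ ?_
        rw [map_smul, LinearMap.smul_apply, smul_eq_mul, repr_eq_div_of_isOrthoᵢ e he hc]
        simp only [toBilinForm_apply]

/-- **Operator norm versus Hilbert–Schmidt norm**: for a Riemannian metric, a bilinear form `T`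
on a fibre and a vector `v`, `g⁻¹(T(v,·), T(v,·)) ≤ |T|²_g g(v, v)` (in an orthogonal frame this
is Cauchy–Schwarz row by row). [folklore] -/
theorem innerDual_apply_le_normSq_mul (hg : g.IsRiemannian) (T : LinearMap.BilinForm ℝ (E b))
    (v : E b) :
    g.innerDual b (T v) (T v) ≤ g.normSq b T * g.val b v v := by
  classical
  obtain ⟨e, he, -⟩ := g.exists_isOrthoᵢ_basis b
  have hpos : ∀ i, 0 < g.val b (e i) (e i) := fun i ↦ hg b (e i) (e.ne_zero i)
  have hc : ∀ i, g.val b (e i) (e i) ≠ 0 := fun i ↦ (hpos i).ne'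
  rw [g.innerDual_eq_sum_of_isOrthoᵢ b e he hc, g.normSq_eq_sum_sq b e he hc T, Finset.sum_mul]
  refine Finset.sum_le_sum fun i _ ↦ ?_
  have hTv : T v (e i) = ∑ j, g.val b v (e j) * T (e j) (e i) / g.val b (e j) (e j) := by
    rw [g.bilin_apply_eq_sum_of_isOrthoᵢ b e he hc T v (e i)]
    refine Finset.sum_congr rfl fun j _ ↦ ?_
    ring
  have hCS := sq_sum_div_le_sum_sq_div_mul Finset.univ (fun j ↦ g.val b v (e j))
    (fun j ↦ T (e j) (e i)) (fun j ↦ g.val b (e j) (e j)) (fun j _ ↦ hpos j)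
  rw [← hTv, ← g.val_self_eq_sum_of_isOrthoᵢ b e he hc v] at hCS
  -- `hCS : T v (e i) ^ 2 ≤ g(v,v) * ∑ j, T(e j)(e i)² / g(e j, e j)`
  have hsum : ∑ j, T (e j) (e i) ^ 2 / (g.val b (e i) (e i) * g.val b (e j) (e j)) =
      (∑ j, T (e j) (e i) ^ 2 / g.val b (e j) (e j)) / g.val b (e i) (e i) := by
    rw [Finset.sum_div]
    refine Finset.sum_congr rfl fun j _ ↦ ?_
    rw [div_div, mul_comm]
  rw [hsum, div_mul_eq_mul_div]
  refine div_le_div_of_nonneg_right ?_ (hpos i).le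
  calc T v (e i) * T v (e i) = T v (e i) ^ 2 := by ring
    _ ≤ g.val b v v * ∑ j, T (e j) (e i) ^ 2 / g.val b (e j) (e j) := hCS
    _ = (∑ j, T (e j) (e i) ^ 2 / g.val b (e j) (e j)) * g.val b v v := mul_comm _ _

/-- **Cauchy–Schwarz for the inverse metric** on a fibre of a Riemannian metric:
`g⁻¹(α, β)² ≤ g⁻¹(α, α) g⁻¹(β, β)`. [folklore] -/
theorem innerDual_sq_le_mul (hg : g.IsRiemannian) (α β : Module.Dual ℝ (E b)) :
    g.innerDual b α β ^ 2 ≤ g.innerDual b α α * g.innerDual b β β := by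
  simp only [innerDual_eq_val_sharp_sharp]
  exact g.val_sq_le_val_mul_val b hg _ _

/-- `g⁻¹(α, α) ≥ 0` on a fibre of a Riemannian metric. Duplicate of `innerDual_self_nonneg`
(`DalembertianCompose`, in the import closure); deprecated restatement (dedup-01128, 2026-08-16).
[folklore] -/
@[deprecated innerDual_self_nonneg (since := "2026-08-16")]
theorem innerDual_self_nonneg' (hg : g.IsRiemannian) (α : Module.Dual ℝ (E b)) :
    0 ≤ g.innerDual b α α :=
  innerDual_self_nonneg g hg b α

/-- **Cauchy–Schwarz in `E = TM ⊕ ℝe`**: for covectors `α, β` and reals `s, t`,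
`(g⁻¹(α, β) - s t)² ≤ (g⁻¹(α, α) + s²)(g⁻¹(β, β) + t²)` — the inequality
`|⟨S, A S'⟩_E| ≤ |S|_E |S'|_E` for the sections `S = ♯α + s e`, `S' = ♯β + t e` of Ruh's bundle
(Aubry 2005, p. 391 and the Kato step p. 394). [cite: Aubry2005, §2 (pp. 391, 394)] -/
theorem sq_innerDual_sub_mul_le (hg : g.IsRiemannian) (α β : Module.Dual ℝ (E b)) (s t : ℝ) :
    (g.innerDual b α β - s * t) ^ 2 ≤
      (g.innerDual b α α + s ^ 2) * (g.innerDual b β β + t ^ 2) := by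
  have h1 := g.innerDual_sq_le_mul b hg α β
  have ha := g.innerDual_self_nonneg hg b α
  have hb := g.innerDual_self_nonneg hg b β
  -- with `x = g⁻¹(α,β)`, `A = g⁻¹(α,α)`, `B = g⁻¹(β,β)`, `y = A t² + B s²`:
  -- `y² - 4x²s²t² = (At² - Bs²)² + 4(AB - x²)s²t² ≥ 0`, so `y ≥ 2|xst| ≥ 2xst`.
  set x := g.innerDual b α β with hx
  set A := g.innerDual b α α with hA
  set B' := g.innerDual b β β with hB
  have hy : 0 ≤ A * t ^ 2 + B' * s ^ 2 := by positivity
  have hsq : (2 * |x * s * t|) ^ 2 ≤ (A * t ^ 2 + B' * s ^ 2) ^ 2 := by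
    have h2 : (2 * |x * s * t|) ^ 2 = 4 * x ^ 2 * s ^ 2 * t ^ 2 := by
      rw [mul_pow, sq_abs]; ring
    rw [h2]
    nlinarith [sq_nonneg (A * t ^ 2 - B' * s ^ 2), mul_nonneg (sub_nonneg.2 h1) (sq_nonneg (s * t))]
  have habs : 2 * |x * s * t| ≤ A * t ^ 2 + B' * s ^ 2 :=
    (pow_le_pow_iff_left₀ (by positivity) hy two_ne_zero).1 hsq
  have hle : -(2 * (x * s * t)) ≤ A * t ^ 2 + B' * s ^ 2 := by
    have := neg_abs_le (x * s * t)
    linarith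
  nlinarith [hle, h1]

end FibreAlgebra

end PseudoRiemannianMetric


end Literature.Geometry.Lorentzian

namespace Literature.Geometry.Riemannian

open Lorentzian Lorentzian.PseudoRiemannianMetric

/-! ### Part C1 (a) — the differential of `|∇F|²` -/

section PointwiseC1a

variable {E : Type*} [NormedAddCommGroup E] [NormedSpace ℝ E] [FiniteDimensional ℝ E]
  {H : Type*} [TopologicalSpace H] {I : ModelWithCorners ℝ E H} [I.Boundaryless]
  {M : Type*} [TopologicalSpace M] [ChartedSpace H M] [IsManifold I ∞ M]
  (g : PseudoRiemannianMetric I ∞ E (TangentSpace I : M → Type _))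

variable [g.HasLeviCivita]

/-- **The differential of `|∇F|²_g`**: `d(g⁻¹(dF, dF))_x (v) = 2 Hess F_x (v, ♯dF)` for a smooth
`F` (metric compatibility of the Levi-Civita connection; the coordinate identity
`MetricCoord.IsMetricOn.fderiv_gradSqAt` read through the chart at `x`). O'Neill 1983, Ch. 3,
Prop. 3.13 ff.; this is `d|S|² = 2⟨D S, S⟩` for Aubry's sections `S = ∇F + F e` (Kato step,
p. 394). [cite: ONeill1983, Ch. 3, Prop. 3.13] -/
theorem mvfderiv_gradSq_apply {F : M → ℝ} (hF : ContMDiff I 𝓘(ℝ, ℝ) ∞ F) (x : M)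
    (v : TangentSpace I x) :
    mvfderiv I (g.gradSq F) x v =
      2 * g.hessian F x v (g.sharp x (mvfderiv I F x : TangentSpace I x →ₗ[ℝ] ℝ)) := by
  -- chart data at `x`
  set G := chartRep I (fun _ ↦ g) x 0 with hGdef
  have hG := val_chartPullback_eq_chartRep (fun _ : ℝ ↦ g) x 0
  have hGm : MetricCoord.IsMetricOn G (extChartAt I x).target :=
    Lorentzian.OpensChart.isMetricOn_repr hG
  set Fh : E → ℝ := F ∘ (extChartAt I x).symm with hFhdef
  have hu0 : extChartAt I x x ∈ (extChartAt I x).target := mem_extChartAt_target x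
  set u₀ : chartTarget I x := ⟨extChartAt I x x, hu0⟩ with hu₀def
  have hΦu₀ : chartInv I x u₀ = x := extChartAt_to_inv x
  have hFh : ContDiffOn ℝ ∞ Fh (extChartAt I x).target := by
    rw [hFhdef, ← contMDiffOn_iff_contDiffOn]
    exact hF.comp_contMDiffOn (contMDiffOn_extChartAt_symm x)
  have hFd : ∀ y, MDifferentiableAt I 𝓘(ℝ, ℝ) F y := fun y ↦ hF.mdifferentiableAt (by simp)
  have hF2 : ∀ y, ContMDiffAt I 𝓘(ℝ, ℝ) 2 F y := fun y ↦
    (hF.of_le (WithTop.coe_le_coe.mpr le_top)).contMDiffAt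
  have hQ : ContMDiff I 𝓘(ℝ, ℝ) ∞ (g.gradSq F) := contMDiff_gradSq g hF
  have hQd : ∀ y, MDifferentiableAt I 𝓘(ℝ, ℝ) (g.gradSq F) y := fun y ↦
    hQ.mdifferentiableAt (by simp)
  have hΦd : MDifferentiableAt 𝓘(ℝ, E) I (chartInv I x) u₀ :=
    ((contMDiff_chartInv x).of_le le_add_self u₀).mdifferentiableAt one_ne_zero
  have hrep : ContDiffAt ℝ 2 Fh (u₀ : E) :=
    (hFh.of_le (WithTop.coe_le_coe.mpr le_top)).contDiffAt ((isOpen_extChartAt_target x).mem_nhds hu0)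
  -- the representative of `|∇F|²` near `φ x`
  have hQrep : (g.gradSq F ∘ (extChartAt I x).symm) =ᶠ[𝓝 (extChartAt I x x)]
      MetricCoord.gradSqAt G Fh := by
    filter_upwards [(isOpen_extChartAt_target x).mem_nhds hu0] with z hz
    exact gradSq_chartInv_eq g x ⟨z, hz⟩ (hFd _)
  -- the identity at `Φ u₀` on vectors `dΦ vc`
  have key : ∀ vc : E,
      mvfderiv I (g.gradSq F) (chartInv I x u₀) (mfderiv 𝓘(ℝ, E) I (chartInv I x) u₀ vc) =
        2 * g.hessian F (chartInv I x u₀) (mfderiv 𝓘(ℝ, E) I (chartInv I x) u₀ vc)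
          (g.sharp (chartInv I x u₀) (mvfderiv I F (chartInv I x u₀) :
            TangentSpace I (chartInv I x u₀) →ₗ[ℝ] ℝ)) := by
    intro vc
    haveI := (chartPullback I g x).hasLeviCivita
    -- left-hand side in the chart
    have hL : mvfderiv I (g.gradSq F) (chartInv I x u₀) (mfderiv 𝓘(ℝ, E) I (chartInv I x) u₀ vc)
        = fderiv ℝ (MetricCoord.gradSqAt G Fh) (extChartAt I x x) vc := by
      rw [← mvfderiv_comp_apply (hQd _) hΦd vc]
      have h1 := LinearMap.congr_fun (mvfderiv_comp_chartInv_toLinearMap x u₀ (hQd _)) vc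
      simp only [ContinuousLinearMap.coe_coe] at h1
      rw [h1, ← hQrep.fderiv_eq]
      rfl
    -- right-hand side in the chart
    have hR : g.hessian F (chartInv I x u₀) (mfderiv 𝓘(ℝ, E) I (chartInv I x) u₀ vc)
          (g.sharp (chartInv I x u₀) (mvfderiv I F (chartInv I x u₀) :
            TangentSpace I (chartInv I x u₀) →ₗ[ℝ] ℝ)) =
        MetricCoord.hessAt G Fh u₀ vc (MetricCoord.sharpAt G u₀ (fderiv ℝ Fh u₀)) := by
      rw [← mfderiv_chartInv_sharpAt_eq g x u₀ (hFd _)]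
      have h2 := g.hessian_comap_apply contMDiff_pullbackBilin_holds (contMDiff_chartInv x)
        (injective_mfderiv_chartInv x) rfl (hF2 (chartInv I x u₀)) vc
        (MetricCoord.sharpAt G u₀ (fderiv ℝ Fh u₀))
      rw [← h2]
      exact Lorentzian.OpensChart.hessian_eq_hessAt hG u₀ (f := F ∘ chartInv I x)
        (fun _ ↦ rfl) hrep vc _
    rw [hL, hR]
    exact hGm.fderiv_gradSqAt hu0 hFh vc
  -- all vectors at `Φ u₀` are of the form `dΦ vc`; then transport from `Φ u₀` to `x`
  have hsurj := mfderiv_mfderivEquivOfInjective_symm (I := I) (I' := 𝓘(ℝ, E)) (chartInv I x) u₀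
    (injective_mfderiv_chartInv x u₀) rfl
  have key2 : ∀ w : TangentSpace I (chartInv I x u₀),
      mvfderiv I (g.gradSq F) (chartInv I x u₀) w =
        2 * g.hessian F (chartInv I x u₀) w
          (g.sharp (chartInv I x u₀) (mvfderiv I F (chartInv I x u₀) :
            TangentSpace I (chartInv I x u₀) →ₗ[ℝ] ℝ)) := by
    intro w
    have h := key ((mfderivEquivOfInjective (I := I) (I' := 𝓘(ℝ, E)) (chartInv I x) u₀
      (injective_mfderiv_chartInv x u₀) rfl).symm w)
    rwa [hsurj] at h
  rw [hΦu₀] at key2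
  exact key2 v


end PointwiseC1a

/-! ### Part C1 — the Kato subsolution inequality for `|S_F| = √(|∇F|² + F²)` -/

section KatoPointwise

variable {E : Type*} [NormedAddCommGroup E] [NormedSpace ℝ E] [FiniteDimensional ℝ E]
  {H : Type*} [TopologicalSpace H] {I : ModelWithCorners ℝ E H} [I.Boundaryless]
  {M : Type*} [TopologicalSpace M] [ChartedSpace H M] [IsManifold I ∞ M]
  (g : PseudoRiemannianMetric I ∞ E (TangentSpace I : M → Type _)) [g.HasLeviCivita]

/-- **`d|S_F|² = 2 T(∇F, ·)`**: for `Q = |∇F|² + F²` and `T = Hess F + F g` (the covariant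
derivative `D^E S_F` of Aubry's section `S_F = ∇F + F e`, p. 391), `dQ_x(v) = 2 T_x(♯dF, v)`.
[cite: Aubry2005, §2 (p. 391) and the Kato step p. 394] -/
theorem mvfderiv_gradSq_add_sq_apply {F : M → ℝ} (hF : ContMDiff I 𝓘(ℝ, ℝ) ∞ F) (x : M)
    (v : TangentSpace I x) :
    mvfderiv I (fun y ↦ g.gradSq F y + F y ^ 2) x v =
      2 * (g.hessian F x + F x • g.toBilinForm x)
        (g.sharp x (mvfderiv I F x : TangentSpace I x →ₗ[ℝ] ℝ)) v := by
  have hFd : MDifferentiableAt I 𝓘(ℝ, ℝ) F x := hF.mdifferentiableAt (by simp)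
  have hF2 : ContMDiffAt I 𝓘(ℝ, ℝ) 2 F x := (hF.of_le (WithTop.coe_le_coe.mpr le_top)).contMDiffAt
  have hQd : MDifferentiableAt I 𝓘(ℝ, ℝ) (g.gradSq F) x :=
    (contMDiff_gradSq g hF).mdifferentiableAt (by simp)
  have hsqd : DifferentiableAt ℝ (fun t : ℝ ↦ t ^ 2) (F x) := (differentiable_pow 2).differentiableAt
  have hF2d : MDifferentiableAt I 𝓘(ℝ, ℝ) (fun y ↦ F y ^ 2) x := hsqd.comp_mdifferentiableAt hFd
  have hadd : mvfderiv I (fun y ↦ g.gradSq F y + F y ^ 2) x =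
      mvfderiv I (g.gradSq F) x + mvfderiv I (fun y ↦ F y ^ 2) x := mvfderiv_fun_add hQd hF2d
  have hsq : mvfderiv I (fun y ↦ F y ^ 2) x v = 2 * F x * mvfderiv I F x v := by
    have h := mvfderiv_real_comp (I := I) (ζ := fun t : ℝ ↦ t ^ 2) hsqd hFd v
    have hd : deriv (fun t : ℝ ↦ t ^ 2) (F x) = 2 * F x := by simp
    rw [hd] at h
    exact h
  rw [hadd, _root_.add_apply, hsq, mvfderiv_gradSq_apply g hF x v]
  have hs : g.hessian F x v (g.sharp x (mvfderiv I F x : TangentSpace I x →ₗ[ℝ] ℝ)) =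
      g.hessian F x (g.sharp x (mvfderiv I F x : TangentSpace I x →ₗ[ℝ] ℝ)) v :=
    (g.hessian_symm_holds hF2).eq _ _
  rw [hs, LinearMap.add_apply, LinearMap.smul_apply]
  simp only [LinearMap.add_apply, LinearMap.smul_apply, toBilinForm_apply, val_sharp_apply,
    smul_eq_mul, ContinuousLinearMap.coe_coe]
  ring

/-- **Kato's inequality for `S_F`, squared**: `|d|S_F|²|² ≤ 4 |D^E S_F|² |S_F|²`, i.e. for
`Q = |∇F|² + F²`, `T = Hess F + F g` and a Riemannian `g`:
`g⁻¹(dQ, dQ) ≤ 4 |T|²_g Q` (from `dQ = 2 T(♯dF, ·)` and `g⁻¹(T(v,·), T(v,·)) ≤ |T|² g(v, v)`).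
[cite: Aubry2005, §2, proof of Lemme 11, Kato step (p. 394)] -/
theorem gradSq_gradSq_add_sq_le (hg : g.IsRiemannian) {F : M → ℝ} (hF : ContMDiff I 𝓘(ℝ, ℝ) ∞ F)
    (x : M) :
    g.gradSq (fun y ↦ g.gradSq F y + F y ^ 2) x ≤
      4 * g.normSq x (g.hessian F x + F x • g.toBilinForm x) * (g.gradSq F x + F x ^ 2) := by
  set T : LinearMap.BilinForm ℝ (TangentSpace I x) := g.hessian F x + F x • g.toBilinForm x with hT
  set α : Module.Dual ℝ (TangentSpace I x) := (mvfderiv I F x : TangentSpace I x →ₗ[ℝ] ℝ) with hα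
  have hdQ : (mvfderiv I (fun y ↦ g.gradSq F y + F y ^ 2) x : TangentSpace I x →ₗ[ℝ] ℝ) =
      (2 : ℝ) • T (g.sharp x α) := by
    ext v
    rw [ContinuousLinearMap.coe_coe, mvfderiv_gradSq_add_sq_apply g hF x v, LinearMap.smul_apply,
      smul_eq_mul]
  have h1 := g.innerDual_apply_le_normSq_mul x hg T (g.sharp x α)
  have h2 : g.val x (g.sharp x α) (g.sharp x α) = g.gradSq F x := by
    rw [PseudoRiemannianMetric.gradSq, innerDual_eq_val_sharp_sharp]
  have hN : 0 ≤ g.normSq x T := g.normSq_nonneg x hg T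
  have hF2 : 0 ≤ g.normSq x T * F x ^ 2 := mul_nonneg hN (sq_nonneg _)
  have hQ : g.gradSq (fun y ↦ g.gradSq F y + F y ^ 2) x =
      4 * g.innerDual x (T (g.sharp x α)) (T (g.sharp x α)) := by
    rw [PseudoRiemannianMetric.gradSq, hdQ, innerDual_smul_left, innerDual_smul_right]
    ring
  rw [hQ]
  rw [h2] at h1
  nlinarith [h1, hF2]

omit [I.Boundaryless] [g.HasLeviCivita] in
/-- **Cauchy–Schwarz in Ruh's bundle `E = TM ⊕ ℝe`, with roots**:
`|g⁻¹(α, β) - s t| ≤ √(g⁻¹(α,α) + s²) √(g⁻¹(β,β) + t²)`. [cite: Aubry2005, §2 (pp. 391, 394)] -/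
theorem abs_innerDual_sub_mul_le (hg : g.IsRiemannian) (x : M)
    (α β : Module.Dual ℝ (TangentSpace I x)) (s t : ℝ) :
    |g.innerDual x α β - s * t| ≤
      Real.sqrt (g.innerDual x α α + s ^ 2) * Real.sqrt (g.innerDual x β β + t ^ 2) := by
  rw [← Real.sqrt_mul (add_nonneg (g.innerDual_self_nonneg hg x α) (sq_nonneg _))]
  exact Real.abs_le_sqrt (g.sq_innerDual_sub_mul_le x hg α β s t)

/-- **The Bochner formula for `|S_F|² = |∇F|² + F²`** (Aubry 2005, Lemme 8 and the Kato step,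
p. 394, for an arbitrary smooth `F`): with `T = Hess F + F g`, `m = dim M` and
`w = Δ_g F + m F`,

  `Δ_g(|∇F|² + F²) = 2|T|²_g + 2 (Ric(∇F,∇F) − (m−1)|∇F|²) + 2 (g⁻¹(dF, dw) − F w)`.

For `F` in the span of eigenfunctions `Δ fᵢ = −μᵢ fᵢ` one has `w = Σ αᵢ (m − μᵢ) fᵢ`, and the last
bracket is `⟨Δ^E_sph S_F, A S_F⟩_E` of Lemme 8 (`Δ^E_sph S_f = (λ − n) A S_f`). Proof:
`dalembertian_gradSq_eq` (Bochner), `Δ(F²) = 2|dF|² + 2FΔF`, `|T|² = |Hess F|² + 2FΔF + mF²`.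
[cite: Aubry2005, §2, Lemme 8 (p. 391) and proof of Lemme 11 (p. 394)] -/
theorem dalembertian_gradSq_add_sq_eq {F : M → ℝ} (hF : ContMDiff I 𝓘(ℝ, ℝ) ∞ F) (x : M) :
    g.dalembertian (fun y ↦ g.gradSq F y + F y ^ 2) x =
      2 * g.normSq x (g.hessian F x + F x • g.toBilinForm x)
      + 2 * (g.ricci x (g.sharp x (mvfderiv I F x : TangentSpace I x →ₗ[ℝ] ℝ))
              (g.sharp x (mvfderiv I F x : TangentSpace I x →ₗ[ℝ] ℝ))
            - ((Module.finrank ℝ E : ℝ) - 1) * g.gradSq F x)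
      + 2 * (g.innerDual x (mvfderiv I F x : TangentSpace I x →ₗ[ℝ] ℝ)
              (mvfderiv I (fun y ↦ g.dalembertian F y + (Module.finrank ℝ E : ℝ) * F y) x :
                TangentSpace I x →ₗ[ℝ] ℝ)
            - F x * (g.dalembertian F x + (Module.finrank ℝ E : ℝ) * F x)) := by
  set m : ℝ := (Module.finrank ℝ E : ℝ) with hm
  have h2 : (2 : ℕ∞ω) ≤ ∞ := WithTop.coe_le_coe.mpr le_top
  have hF2 : ∀ y, ContMDiffAt I 𝓘(ℝ, ℝ) 2 F y := fun y ↦ (hF.of_le h2).contMDiffAt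
  have hFd : MDifferentiableAt I 𝓘(ℝ, ℝ) F x := hF.mdifferentiableAt (by simp)
  have hQ2 : ContMDiffAt I 𝓘(ℝ, ℝ) 2 (g.gradSq F) x :=
    ((contMDiff_gradSq g hF).of_le h2).contMDiffAt
  have hsq : ContMDiff I 𝓘(ℝ, ℝ) ∞ (fun y ↦ F y ^ 2) := (contDiff_id.pow 2).comp_contMDiff hF
  have hsq2 : ContMDiffAt I 𝓘(ℝ, ℝ) 2 (fun y ↦ F y ^ 2) x := (hsq.of_le h2).contMDiffAt
  have hL : ContMDiff I 𝓘(ℝ, ℝ) ∞ (g.dalembertian F) := contMDiff_dalembertian g hF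
  have hLd : MDifferentiableAt I 𝓘(ℝ, ℝ) (g.dalembertian F) x := hL.mdifferentiableAt (by simp)
  have hmF : MDifferentiableAt I 𝓘(ℝ, ℝ) (fun y ↦ m * F y) x :=
    (mdifferentiableAt_const (c := m)).mul hFd
  -- `Δ(|∇F|² + F²) = Δ|∇F|² + Δ(F²)`
  have hfun : (fun y ↦ g.gradSq F y + F y ^ 2) = fun y ↦ g.gradSq F y + 1 * F y ^ 2 := by
    funext y; rw [one_mul]
  rw [hfun, dalembertian_add_const_mul g 1 hQ2 hsq2, one_mul, dalembertian_gradSq_eq g hF x,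
    KarpukhinStern.dalembertian_sq g (hF2 x)]
  -- `|T|² = |Hess F|² + 2 F ΔF + m F²`
  have hs : ∀ v w, g.hessian F x v w = g.hessian F x w v := fun v w ↦
    (g.hessian_symm_holds (hF2 x)).eq v w
  rw [g.normSq_add_smul_toBilinForm x hs (F x)]
  -- `dw = dΔF + m dF`
  have hdw : (mvfderiv I (fun y ↦ g.dalembertian F y + m * F y) x : TangentSpace I x →ₗ[ℝ] ℝ) =
      (mvfderiv I (g.dalembertian F) x : TangentSpace I x →ₗ[ℝ] ℝ)
        + m • (mvfderiv I F x : TangentSpace I x →ₗ[ℝ] ℝ) := by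
    ext v
    rw [ContinuousLinearMap.coe_coe, mvfderiv_fun_add hLd hmF,
      mvfderiv_fun_mul (mdifferentiableAt_const (c := m)) hFd]
    simp [mvfderiv_const]
  rw [hdw, g.innerDual_comm x _ (_ + _), innerDual_add_left, innerDual_smul_left,
    g.innerDual_comm x (mvfderiv I (g.dalembertian F) x : TangentSpace I x →ₗ[ℝ] ℝ)]
  -- `tr Hess F = ΔF`, `g⁻¹(dF, dF) = |∇F|²`
  have htr : g.trace x (g.hessian F x) = g.dalembertian F x := rfl
  have hgs : g.innerDual x (mvfderiv I F x : TangentSpace I x →ₗ[ℝ] ℝ)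
      (mvfderiv I F x : TangentSpace I x →ₗ[ℝ] ℝ) = g.gradSq F x := rfl
  rw [htr, hgs]
  ring

/-- **Derivatives of `t ↦ √(t + δ²)`** at a point with `t₀ + δ² > 0`: the function is `C²`
there, with `ζ'(t₀) = 1/(2√(t₀+δ²))` and `ζ''(t₀) = −1/(4 √(t₀+δ²)³)`. [folklore] -/
theorem sqrt_add_sq_derivs (δ t₀ : ℝ) (ht : 0 < t₀ + δ ^ 2) :
    ContDiffAt ℝ 2 (fun t : ℝ ↦ Real.sqrt (t + δ ^ 2)) t₀ ∧
      deriv (fun t : ℝ ↦ Real.sqrt (t + δ ^ 2)) t₀ = 1 / (2 * Real.sqrt (t₀ + δ ^ 2)) ∧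
      deriv (deriv (fun t : ℝ ↦ Real.sqrt (t + δ ^ 2))) t₀ =
        -1 / (4 * Real.sqrt (t₀ + δ ^ 2) ^ 3) := by
  have hd : ∀ t : ℝ, 0 < t + δ ^ 2 →
      HasDerivAt (fun t : ℝ ↦ Real.sqrt (t + δ ^ 2)) (1 / (2 * Real.sqrt (t + δ ^ 2))) t := by
    intro t ht'
    have h := ((hasDerivAt_id t).add_const (δ ^ 2)).sqrt (ne_of_gt ht')
    simpa using h
  refine ⟨?_, (hd t₀ ht).deriv, ?_⟩
  · exact (Real.contDiffAt_sqrt ht.ne').comp t₀ (contDiffAt_id.add contDiffAt_const)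
  · have hopen : {t : ℝ | 0 < t + δ ^ 2} ∈ 𝓝 t₀ :=
      (isOpen_lt continuous_const (continuous_id.add continuous_const)).mem_nhds ht
    have hev : deriv (fun t : ℝ ↦ Real.sqrt (t + δ ^ 2)) =ᶠ[𝓝 t₀]
        fun t ↦ 1 / (2 * Real.sqrt (t + δ ^ 2)) := by
      filter_upwards [hopen] with t ht'
      exact (hd t ht').deriv
    rw [hev.deriv_eq]
    set s := Real.sqrt (t₀ + δ ^ 2) with hs
    have hs0 : 0 < s := Real.sqrt_pos.2 ht
    have h2 : HasDerivAt (fun t : ℝ ↦ 2 * Real.sqrt (t + δ ^ 2)) (2 * (1 / (2 * s))) t₀ :=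
      (hd t₀ ht).const_mul 2
    have h3 := h2.inv (by positivity)
    have hfun : (fun t : ℝ ↦ 1 / (2 * Real.sqrt (t + δ ^ 2))) =
        (fun t : ℝ ↦ 2 * Real.sqrt (t + δ ^ 2))⁻¹ := by
      funext t; simp [one_div]
    rw [hfun, h3.deriv]
    field_simp
    ring

omit [I.Boundaryless] [g.HasLeviCivita] in
/-- `|S_F|² + δ² = |∇F|² + F² + δ²` is positive for `δ > 0` and a Riemannian `g`. [folklore] -/
theorem gradSq_add_sq_add_sq_pos (hg : g.IsRiemannian) (F : M → ℝ) {δ : ℝ} (hδ : 0 < δ) (y : M) :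
    0 < g.gradSq F y + F y ^ 2 + δ ^ 2 := by
  have h1 : 0 ≤ g.gradSq F y := by
    rw [PseudoRiemannianMetric.gradSq, innerDual_eq_val_sharp_sharp]
    exact g.val_self_nonneg' y hg _
  positivity

omit [g.HasLeviCivita] in
/-- **The regularised length `u_δ = √(|S_F|² + δ²)` is smooth** (`δ > 0`, `g` Riemannian).
[cite: Aubry2005, §2, proof of Lemme 11 (p. 394)] -/
theorem contMDiff_sqrt_gradSq_add_sq (hg : g.IsRiemannian) {F : M → ℝ}
    (hF : ContMDiff I 𝓘(ℝ, ℝ) ∞ F) {δ : ℝ} (hδ : 0 < δ) :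
    ContMDiff I 𝓘(ℝ, ℝ) ∞ (fun y ↦ Real.sqrt (g.gradSq F y + F y ^ 2 + δ ^ 2)) := by
  have hQ : ContMDiff I 𝓘(ℝ, ℝ) ∞ (fun y ↦ g.gradSq F y + F y ^ 2 + δ ^ 2) :=
    ((contMDiff_gradSq g hF).add ((contDiff_id.pow 2).comp_contMDiff hF)).add contMDiff_const
  intro y
  exact (Real.contDiffAt_sqrt (gradSq_add_sq_add_sq_pos g hg F hδ y).ne').comp_contMDiffAt
    (f := fun y ↦ g.gradSq F y + F y ^ 2 + δ ^ 2) (hQ y)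

/-- **The Kato subsolution inequality** (Aubry 2005, proof of Lemme 11, first display, p. 394:
"Une technique à la Kato nous donne l'inégalité `u Δu ≤ … ≤ |Δ^E_sph S| u`"), for an ARBITRARY
smooth `F` on a Riemannian manifold with `Ric ≥ (m − 1) g`: the regularised length
`u_δ = √(|∇F|² + F² + δ²)` of the section `S_F = ∇F + F e` satisfies, pointwise,

  `−Δ_g u_δ ≤ |S_w| = √(|∇w|² + w²)`,  `w = Δ_g F + m F`

(`Δ_g = tr_g Hess`; for `F = Σ αᵢ fᵢ` in the span of eigenfunctions, `−S_w = Δ^E_sph S_F` up to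
the isometry `A`, by Lemme 8). Ingredients: the chain rule `dalembertian_real_comp`, the Bochner
formula `dalembertian_gradSq_add_sq_eq` with `Ric ≥ m − 1` and Cauchy–Schwarz in `E`, and Kato's
inequality `gradSq_gradSq_add_sq_le`. [cite: Aubry2005, §2, proof of Lemme 11 (p. 394)] -/
theorem neg_dalembertian_sqrt_le (hg : g.IsRiemannian)
    (hRic : ∀ (x : M) (v : TangentSpace I x),
      ((Module.finrank ℝ E : ℝ) - 1) * g.val x v v ≤ g.ricci x v v)
    {F : M → ℝ} (hF : ContMDiff I 𝓘(ℝ, ℝ) ∞ F) {δ : ℝ} (hδ : 0 < δ) (x : M) :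
    -g.dalembertian (fun y ↦ Real.sqrt (g.gradSq F y + F y ^ 2 + δ ^ 2)) x ≤
      Real.sqrt (g.gradSq (fun y ↦ g.dalembertian F y + (Module.finrank ℝ E : ℝ) * F y) x
        + (g.dalembertian F x + (Module.finrank ℝ E : ℝ) * F x) ^ 2) := by
  set m : ℝ := (Module.finrank ℝ E : ℝ) with hm
  set Q : M → ℝ := fun y ↦ g.gradSq F y + F y ^ 2 with hQdef
  set w : M → ℝ := fun y ↦ g.dalembertian F y + m * F y with hwdef
  have h2 : (2 : ℕ∞ω) ≤ ∞ := WithTop.coe_le_coe.mpr le_top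
  have hgs0 : ∀ y, 0 ≤ g.gradSq F y := fun y ↦ by
    rw [PseudoRiemannianMetric.gradSq, innerDual_eq_val_sharp_sharp]
    exact g.val_self_nonneg' y hg _
  have hQ0 : 0 ≤ Q x := add_nonneg (hgs0 x) (sq_nonneg _)
  have hQδ : 0 < Q x + δ ^ 2 := by positivity
  have hQs : ContMDiff I 𝓘(ℝ, ℝ) ∞ Q :=
    (contMDiff_gradSq g hF).add ((contDiff_id.pow 2).comp_contMDiff hF)
  have hQ2 : ContMDiffAt I 𝓘(ℝ, ℝ) 2 Q x := (hQs.of_le h2).contMDiffAt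
  have hfun : (fun y ↦ Real.sqrt (g.gradSq F y + F y ^ 2 + δ ^ 2)) =
      (fun t : ℝ ↦ Real.sqrt (t + δ ^ 2)) ∘ Q := rfl
  obtain ⟨hζ, hζ', hζ''⟩ := sqrt_add_sq_derivs δ (Q x) hQδ
  rw [hfun, g.dalembertian_real_comp hQ2 hζ, hζ', hζ'']
  set s := Real.sqrt (Q x + δ ^ 2) with hsdef
  have hs0 : 0 < s := Real.sqrt_pos.2 hQδ
  have hs2 : s ^ 2 = Q x + δ ^ 2 := Real.sq_sqrt hQδ.le
  have hs3 : 0 < s ^ 3 := pow_pos hs0 3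
  -- the three pointwise inputs
  set N := g.normSq x (g.hessian F x + F x • g.toBilinForm x) with hN
  have hN0 : 0 ≤ N := g.normSq_nonneg x hg _
  have hG : g.innerDual x (mvfderiv I Q x : TangentSpace I x →ₗ[ℝ] ℝ)
      (mvfderiv I Q x : TangentSpace I x →ₗ[ℝ] ℝ) ≤ 4 * N * Q x :=
    gradSq_gradSq_add_sq_le g hg hF x
  have hB := dalembertian_gradSq_add_sq_eq g hF x
  set R := Real.sqrt (g.gradSq w x + w x ^ 2) with hR
  have hR0 : 0 ≤ R := Real.sqrt_nonneg _
  have hRic' : 0 ≤ g.ricci x (g.sharp x (mvfderiv I F x : TangentSpace I x →ₗ[ℝ] ℝ))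
      (g.sharp x (mvfderiv I F x : TangentSpace I x →ₗ[ℝ] ℝ)) - (m - 1) * g.gradSq F x := by
    have h := hRic x (g.sharp x (mvfderiv I F x : TangentSpace I x →ₗ[ℝ] ℝ))
    have hq : g.gradSq F x = g.val x (g.sharp x (mvfderiv I F x : TangentSpace I x →ₗ[ℝ] ℝ))
        (g.sharp x (mvfderiv I F x : TangentSpace I x →ₗ[ℝ] ℝ)) := by
      rw [PseudoRiemannianMetric.gradSq, innerDual_eq_val_sharp_sharp]
    rw [hq]
    linarith
  have hCS : |g.innerDual x (mvfderiv I F x : TangentSpace I x →ₗ[ℝ] ℝ)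
      (mvfderiv I w x : TangentSpace I x →ₗ[ℝ] ℝ) - F x * w x| ≤ Real.sqrt (Q x) * R := by
    have h := abs_innerDual_sub_mul_le g hg x (mvfderiv I F x : TangentSpace I x →ₗ[ℝ] ℝ)
      (mvfderiv I w x : TangentSpace I x →ₗ[ℝ] ℝ) (F x) (w x)
    exact h
  have hP : -(Real.sqrt (Q x) * R) ≤ g.innerDual x (mvfderiv I F x : TangentSpace I x →ₗ[ℝ] ℝ)
      (mvfderiv I w x : TangentSpace I x →ₗ[ℝ] ℝ) - F x * w x := by
    have := neg_abs_le (g.innerDual x (mvfderiv I F x : TangentSpace I x →ₗ[ℝ] ℝ)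
      (mvfderiv I w x : TangentSpace I x →ₗ[ℝ] ℝ) - F x * w x)
    linarith
  -- `ΔQ ≥ 2N - 2√Q R`
  have hL : 2 * N - 2 * (Real.sqrt (Q x) * R) ≤ g.dalembertian Q x := by
    rw [hQdef, hB]
    linarith
  have hsq : Real.sqrt (Q x) ≤ s := by
    rw [hsdef]
    exact Real.sqrt_le_sqrt (by linarith [sq_nonneg δ])
  -- assemble: `-(ζ'' G + ζ' L) ≤ R`
  have key : -(-1 / (4 * s ^ 3) * g.innerDual x (mvfderiv I Q x : TangentSpace I x →ₗ[ℝ] ℝ)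
      (mvfderiv I Q x : TangentSpace I x →ₗ[ℝ] ℝ) + 1 / (2 * s) * g.dalembertian Q x) ≤ R := by
    rw [show -(-1 / (4 * s ^ 3) * g.innerDual x (mvfderiv I Q x : TangentSpace I x →ₗ[ℝ] ℝ)
        (mvfderiv I Q x : TangentSpace I x →ₗ[ℝ] ℝ) + 1 / (2 * s) * g.dalembertian Q x) =
        (g.innerDual x (mvfderiv I Q x : TangentSpace I x →ₗ[ℝ] ℝ)
          (mvfderiv I Q x : TangentSpace I x →ₗ[ℝ] ℝ) / 4 - s ^ 2 * (g.dalembertian Q x / 2)) / s ^ 3 by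
      field_simp; ring]
    rw [div_le_iff₀ hs3]
    have e1 : g.innerDual x (mvfderiv I Q x : TangentSpace I x →ₗ[ℝ] ℝ)
        (mvfderiv I Q x : TangentSpace I x →ₗ[ℝ] ℝ) / 4 ≤ N * Q x := by linarith
    have e2 : s ^ 2 * (N - Real.sqrt (Q x) * R) ≤ s ^ 2 * (g.dalembertian Q x / 2) :=
      mul_le_mul_of_nonneg_left (by linarith) (sq_nonneg s)
    have e3 : s ^ 2 * (Real.sqrt (Q x) * R) ≤ R * s ^ 3 := by
      have : Real.sqrt (Q x) * R ≤ s * R := mul_le_mul_of_nonneg_right hsq hR0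
      nlinarith [sq_nonneg s]
    have e4 : N * Q x - s ^ 2 * N = -(N * δ ^ 2) := by rw [hs2]; ring
    nlinarith [mul_nonneg hN0 (sq_nonneg δ)]
  exact key

end KatoPointwise

/-! ### Part C2 — the energy identity `∫|d(u^p)|² = −(p²/(2p−1)) ∫ u^{2p−1} Δu` on a closed manifold -/

section IntegratedC2

variable {m : ℕ} {H : Type*} [TopologicalSpace H]
  {I : ModelWithCorners ℝ (EuclideanSpace ℝ (Fin m)) H} [I.Boundaryless]
  {N : Type*} [TopologicalSpace N] [ChartedSpace H N] [IsManifold I ∞ N] [CompactSpace N]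
  [T2Space N] [MeasurableSpace N] [BorelSpace N]
  (h : ContMDiffRiemannianMetric I ∞ (EuclideanSpace ℝ (Fin m)) (TangentSpace I : N → Type _))
  [(ofRiemannian h).HasLeviCivita]

omit [I.Boundaryless] [CompactSpace N] [T2Space N] [MeasurableSpace N] [BorelSpace N]
  [(ofRiemannian h).HasLeviCivita] in
/-- **Gradient of a composite**: `|∇(ζ ∘ u)|² = ζ'(u)² |∇u|²` (`d(ζ ∘ u) = ζ'(u) du`). [folklore] -/
theorem gradSq_real_comp {u : N → ℝ} {ζ : ℝ → ℝ} {x : N} (hζ : DifferentiableAt ℝ ζ (u x))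
    (hu : MDifferentiableAt I 𝓘(ℝ, ℝ) u x) :
    (ofRiemannian h).gradSq (ζ ∘ u) x = deriv ζ (u x) ^ 2 * (ofRiemannian h).gradSq u x := by
  have hd : (mvfderiv I (ζ ∘ u) x : TangentSpace I x →ₗ[ℝ] ℝ) =
      deriv ζ (u x) • (mvfderiv I u x : TangentSpace I x →ₗ[ℝ] ℝ) := by
    ext v
    rw [ContinuousLinearMap.coe_coe, mvfderiv_real_comp hζ hu v, LinearMap.smul_apply,
      ContinuousLinearMap.coe_coe, smul_eq_mul]
  rw [PseudoRiemannianMetric.gradSq, PseudoRiemannianMetric.gradSq, hd, innerDual_smul_left,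
    innerDual_smul_right]
  ring

omit [I.Boundaryless] [CompactSpace N] [T2Space N] [MeasurableSpace N] [BorelSpace N]
  [IsManifold I ∞ N] in
/-- Real powers of a positive smooth function are smooth. [folklore] -/
theorem contMDiff_rpow_of_pos {u : N → ℝ} (hu : ContMDiff I 𝓘(ℝ, ℝ) ∞ u) (hpos : ∀ y, 0 < u y)
    (s : ℝ) : ContMDiff I 𝓘(ℝ, ℝ) ∞ (fun y ↦ u y ^ s) := fun y ↦
  (Real.contDiffAt_rpow_const_of_ne (p := s) (hpos y).ne').comp_contMDiffAt (f := u) (hu y)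

/-- **The energy identity of the Moser iteration** (Aubry 2005, proof of Lemme 11, second display,
p. 394: "`‖d(u^p)‖₂² = (p²/(2p−1)) ∫ (uΔu) u^{2p−2}`", here with `Δ_h = tr_h Hess = −Δ_Aubry`): for a
smooth POSITIVE function `u` on a closed Riemannian manifold and a real `p > 1/2`,

  `∫ |∇(u^p)|²_h dμ_h = −(p²/(2p−1)) ∫ u^{2p−1} Δ_h u dμ_h`

(`|∇(u^p)|² = p² u^{2p−2}|∇u|²` and Green's identity
`∫ u^{2p−1} Δ_h u = −(2p−1) ∫ u^{2p−2} |∇u|²`). [cite: Aubry2005, §2, proof of Lemme 11 (p. 394)] -/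
theorem integral_gradSq_rpow_eq {u : N → ℝ} (hu : ContMDiff I 𝓘(ℝ, ℝ) ∞ u) (hpos : ∀ y, 0 < u y)
    {p : ℝ} (hp : 1 / 2 < p) :
    ∫ x, (ofRiemannian h).gradSq (fun y ↦ u y ^ p) x ∂riemannianMeasure h =
      -(p ^ 2 / (2 * p - 1)) *
        ∫ x, u x ^ (2 * p - 1) * (ofRiemannian h).dalembertian u x ∂riemannianMeasure h := by
  have h2p : 0 < 2 * p - 1 := by linarith
  have hud : ∀ y, MDifferentiableAt I 𝓘(ℝ, ℝ) u y := fun y ↦ hu.mdifferentiableAt (by simp)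
  -- the multiplier `v = u^{2p-1}` and its differential
  have hv : ContMDiff I 𝓘(ℝ, ℝ) ∞ (fun y ↦ u y ^ (2 * p - 1)) := contMDiff_rpow_of_pos hu hpos _
  have hGreen := integral_mul_dalembertian_eq_neg_integral_innerDual h (u := fun y ↦ u y ^ (2 * p - 1))
    (f := u) (hv.of_le (by exact_mod_cast le_top)) (hu.of_le (WithTop.coe_le_coe.mpr le_top))
  have hdv : ∀ x, (ofRiemannian h).innerDual x
      (mvfderiv I (fun y ↦ u y ^ (2 * p - 1)) x).toLinearMap (mvfderiv I u x).toLinearMap =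
      (2 * p - 1) * u x ^ (2 * p - 2) * (ofRiemannian h).gradSq u x := by
    intro x
    have hζ : HasDerivAt (fun t : ℝ ↦ t ^ (2 * p - 1)) ((2 * p - 1) * u x ^ (2 * p - 1 - 1)) (u x) :=
      Real.hasDerivAt_rpow_const (Or.inl (hpos x).ne')
    have hd : (mvfderiv I (fun y ↦ u y ^ (2 * p - 1)) x : TangentSpace I x →ₗ[ℝ] ℝ) =
        ((2 * p - 1) * u x ^ (2 * p - 2)) • (mvfderiv I u x : TangentSpace I x →ₗ[ℝ] ℝ) := by
      ext v
      have h1 := mvfderiv_real_comp (I := I) (ζ := fun t : ℝ ↦ t ^ (2 * p - 1)) hζ.differentiableAt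
        (hud x) v
      rw [hζ.deriv, show (2 * p - 1 - 1 : ℝ) = 2 * p - 2 by ring] at h1
      rw [ContinuousLinearMap.coe_coe, LinearMap.smul_apply, ContinuousLinearMap.coe_coe, smul_eq_mul]
      exact h1
    rw [hd, innerDual_smul_left]
    rfl
  -- `|∇(u^p)|² = p² u^{2p-2} |∇u|²`
  have hgrad : ∀ x, (ofRiemannian h).gradSq (fun y ↦ u y ^ p) x =
      p ^ 2 * u x ^ (2 * p - 2) * (ofRiemannian h).gradSq u x := by
    intro x
    have hζ : HasDerivAt (fun t : ℝ ↦ t ^ p) (p * u x ^ (p - 1)) (u x) :=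
      Real.hasDerivAt_rpow_const (Or.inl (hpos x).ne')
    have h1 := gradSq_real_comp h (ζ := fun t : ℝ ↦ t ^ p) hζ.differentiableAt (hud x)
    rw [hζ.deriv] at h1
    rw [show ((fun y ↦ u y ^ p) : N → ℝ) = (fun t : ℝ ↦ t ^ p) ∘ u from rfl, h1]
    have hpow : (u x ^ (p - 1)) ^ 2 = u x ^ (2 * p - 2) := by
      rw [← Real.rpow_natCast, ← Real.rpow_mul (hpos x).le]
      congr 1
      push_cast
      ring
    rw [mul_pow, hpow]
  simp_rw [hgrad]
  have hG' : ∫ x, u x ^ (2 * p - 1) * (ofRiemannian h).dalembertian u x ∂riemannianMeasure h =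
      -((2 * p - 1) * ∫ x, u x ^ (2 * p - 2) * (ofRiemannian h).gradSq u x ∂riemannianMeasure h) := by
    rw [hGreen, ← integral_const_mul]
    congr 1
    refine integral_congr_ae (Eventually.of_forall fun x ↦ ?_)
    simp only [hdv x]
    ring
  rw [hG']
  have hint : ∫ x, p ^ 2 * u x ^ (2 * p - 2) * (ofRiemannian h).gradSq u x ∂riemannianMeasure h =
      p ^ 2 * ∫ x, u x ^ (2 * p - 2) * (ofRiemannian h).gradSq u x ∂riemannianMeasure h := by
    rw [← integral_const_mul]
    refine integral_congr_ae (Eventually.of_forall fun x ↦ ?_)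
    ring
  rw [hint, neg_mul_neg, div_mul_eq_mul_div, eq_div_iff h2p.ne']
  ring

/-- **The energy inequality of the Moser iteration** (Aubry 2005, p. 394, second display): for
the regularised length `u_δ = √(|∇F|² + F² + δ²)` of `S_F` under `Ric ≥ m − 1` on a closed
Riemannian `m`-manifold and a real `p > 1/2`,

  `∫ |∇(u_δ^p)|² dμ ≤ (p²/(2p−1)) ∫ √(|∇w|² + w²) u_δ^{2p−1} dμ`,  `w = Δ F + m F`

(energy identity `integral_gradSq_rpow_eq` and the Kato subsolution inequality
`neg_dalembertian_sqrt_le`). [cite: Aubry2005, §2, proof of Lemme 11 (p. 394)] -/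
theorem integral_gradSq_rpow_sqrt_le
    (hRic : ∀ (x : N) (v : TangentSpace I x),
      ((m : ℝ) - 1) * h.inner x v v ≤ (ofRiemannian h).ricci x v v)
    {F : N → ℝ} (hF : ContMDiff I 𝓘(ℝ, ℝ) ∞ F) {δ : ℝ} (hδ : 0 < δ) {p : ℝ} (hp : 1 / 2 < p) :
    ∫ x, (ofRiemannian h).gradSq
        (fun y ↦ Real.sqrt ((ofRiemannian h).gradSq F y + F y ^ 2 + δ ^ 2) ^ p) x
        ∂riemannianMeasure h ≤
      p ^ 2 / (2 * p - 1) *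
        ∫ x, Real.sqrt ((ofRiemannian h).gradSq
            (fun y ↦ (ofRiemannian h).dalembertian F y + (m : ℝ) * F y) x
            + ((ofRiemannian h).dalembertian F x + (m : ℝ) * F x) ^ 2)
          * Real.sqrt ((ofRiemannian h).gradSq F x + F x ^ 2 + δ ^ 2) ^ (2 * p - 1)
          ∂riemannianMeasure h := by
  have hg : (ofRiemannian h).IsRiemannian := isRiemannian_ofRiemannian h
  set u : N → ℝ := fun y ↦ Real.sqrt ((ofRiemannian h).gradSq F y + F y ^ 2 + δ ^ 2) with hudef
  set w : N → ℝ := fun y ↦ (ofRiemannian h).dalembertian F y + (m : ℝ) * F y with hwdef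
  have h2p : 0 < 2 * p - 1 := by linarith
  have hpc : 0 ≤ p ^ 2 / (2 * p - 1) := div_nonneg (sq_nonneg _) h2p.le
  have hus : ContMDiff I 𝓘(ℝ, ℝ) ∞ u := contMDiff_sqrt_gradSq_add_sq _ hg hF hδ
  have hupos : ∀ y, 0 < u y := fun y ↦ Real.sqrt_pos.2 (gradSq_add_sq_add_sq_pos _ hg F hδ y)
  have hm : (Module.finrank ℝ (EuclideanSpace ℝ (Fin m)) : ℝ) = m := by
    rw [finrank_euclideanSpace_fin]
  have hRic' : ∀ (x : N) (v : TangentSpace I x),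
      ((Module.finrank ℝ (EuclideanSpace ℝ (Fin m)) : ℝ) - 1) * (ofRiemannian h).val x v v ≤
        (ofRiemannian h).ricci x v v := by
    intro x v
    rw [hm, val_ofRiemannian]
    exact hRic x v
  have hKato : ∀ x, -(ofRiemannian h).dalembertian u x ≤
      Real.sqrt ((ofRiemannian h).gradSq w x + w x ^ 2) := by
    intro x
    have hk := neg_dalembertian_sqrt_le (ofRiemannian h) hg hRic' hF hδ x
    rw [hm] at hk
    exact hk
  rw [integral_gradSq_rpow_eq h hus hupos hp, neg_mul, ← mul_neg, ← integral_neg]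
  refine mul_le_mul_of_nonneg_left ?_ hpc
  -- continuity of the integrands
  have hws : ContMDiff I 𝓘(ℝ, ℝ) ∞ w :=
    (contMDiff_dalembertian _ hF).add (contMDiff_const.mul hF)
  have hQw : ContMDiff I 𝓘(ℝ, ℝ) ∞ (fun x ↦ (ofRiemannian h).gradSq w x + w x ^ 2) :=
    (contMDiff_gradSq _ hws).add ((contDiff_id.pow 2).comp_contMDiff hws)
  have hR : Continuous (fun x ↦ Real.sqrt ((ofRiemannian h).gradSq w x + w x ^ 2)) :=
    Real.continuous_sqrt.comp hQw.continuous
  have hv : Continuous (fun x ↦ u x ^ (2 * p - 1)) := (contMDiff_rpow_of_pos hus hupos _).continuous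
  have hL : Continuous (fun x ↦ (ofRiemannian h).dalembertian u x) :=
    (contMDiff_dalembertian _ hus).continuous
  refine integral_mono ?_ ?_ fun x ↦ ?_
  · exact (integrable_of_continuous h (hv.mul hL)).neg
  · exact integrable_of_continuous h (hR.mul hv)
  · have hvx : 0 < u x ^ (2 * p - 1) := Real.rpow_pos_of_pos (hupos x) _
    have := hKato x
    dsimp only
    nlinarith

end IntegratedC2

/-! ### Part C3 — Hölder, the limit `δ → 0`, and one step of the Moser iteration -/

section MoserStep

variable {m : ℕ} {H : Type*} [TopologicalSpace H]
  {I : ModelWithCorners ℝ (EuclideanSpace ℝ (Fin m)) H} [I.Boundaryless]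
  {N : Type*} [TopologicalSpace N] [ChartedSpace H N] [IsManifold I ∞ N] [CompactSpace N]
  [T2Space N] [MeasurableSpace N] [BorelSpace N]
  (h : ContMDiffRiemannianMetric I ∞ (EuclideanSpace ℝ (Fin m)) (TangentSpace I : N → Type _))

omit [I.Boundaryless] in
/-- Continuous functions on a closed Riemannian manifold lie in every `L^q(dμ_h)`. [folklore] -/
theorem memLp_of_continuous {f : N → ℝ} (hf : Continuous f) (q : ENNReal) :
    MemLp f q (riemannianMeasure h) := by
  haveI := isFiniteMeasure_riemannianMeasure h
  obtain ⟨C, hC⟩ := isCompact_univ.exists_bound_of_continuousOn (f := f) hf.continuousOn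
  exact MemLp.of_bound hf.aestronglyMeasurable C (Eventually.of_forall fun x ↦ hC x (mem_univ x))

omit [I.Boundaryless] in
/-- **Hölder's inequality for normalised integrals** `⨍ = (Vol N)⁻¹ ∫`: for continuous
`f, g ≥ 0` and conjugate exponents `a, b`, `⨍ f g ≤ (⨍ f^a)^{1/a} (⨍ g^b)^{1/b}`. [folklore] -/
theorem normalized_holder {f g : N → ℝ} (hf : Continuous f) (hg : Continuous g)
    (hf0 : ∀ x, 0 ≤ f x) (hg0 : ∀ x, 0 ≤ g x) {a b : ℝ} (hab : a.HolderConjugate b) :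
    (riemannianMeasure h univ).toReal⁻¹ * ∫ x, f x * g x ∂riemannianMeasure h ≤
      ((riemannianMeasure h univ).toReal⁻¹ * ∫ x, f x ^ a ∂riemannianMeasure h) ^ (1 / a) *
      ((riemannianMeasure h univ).toReal⁻¹ * ∫ x, g x ^ b ∂riemannianMeasure h) ^ (1 / b) := by
  set V := (riemannianMeasure h univ).toReal with hV
  have hV0 : 0 ≤ V⁻¹ := inv_nonneg.2 ENNReal.toReal_nonneg
  have hH := integral_mul_le_Lp_mul_Lq_of_nonneg hab (Eventually.of_forall hf0)
    (Eventually.of_forall hg0) (memLp_of_continuous h hf _) (memLp_of_continuous h hg _)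
  have hIf : 0 ≤ ∫ x, f x ^ a ∂riemannianMeasure h :=
    integral_nonneg fun x ↦ Real.rpow_nonneg (hf0 x) _
  have hIg : 0 ≤ ∫ x, g x ^ b ∂riemannianMeasure h :=
    integral_nonneg fun x ↦ Real.rpow_nonneg (hg0 x) _
  have hsplit : V⁻¹ = V⁻¹ ^ (1 / a) * V⁻¹ ^ (1 / b) := by
    rw [← Real.rpow_add' hV0 (by rw [one_div, one_div, hab.inv_add_inv_eq_one]; norm_num),
      one_div, one_div, hab.inv_add_inv_eq_one, Real.rpow_one]
  calc V⁻¹ * ∫ x, f x * g x ∂riemannianMeasure h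
      ≤ V⁻¹ * ((∫ x, f x ^ a ∂riemannianMeasure h) ^ (1 / a) *
          (∫ x, g x ^ b ∂riemannianMeasure h) ^ (1 / b)) := mul_le_mul_of_nonneg_left hH hV0
    _ = (V⁻¹ * ∫ x, f x ^ a ∂riemannianMeasure h) ^ (1 / a) *
          (V⁻¹ * ∫ x, g x ^ b ∂riemannianMeasure h) ^ (1 / b) := by
        rw [Real.mul_rpow hV0 hIf, Real.mul_rpow hV0 hIg]
        conv_lhs => rw [hsplit]
        ring

omit [I.Boundaryless] in
/-- **The limit `δ → 0⁺` of `∫ (Q + δ²)^p dμ`** for a continuous `Q ≥ 0` and `p ≥ 0` on a closed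
manifold: dominated convergence (bound `(Q + 1)^p` for `δ < 1`).
[cite: Aubry2005, §2, proof of Lemme 11 ("en faisant tendre ε vers 0", p. 394)] -/
theorem tendsto_integral_add_sq_rpow {Q : N → ℝ} (hQ : Continuous Q) (hQ0 : ∀ x, 0 ≤ Q x)
    {p : ℝ} (hp : 0 ≤ p) :
    Tendsto (fun δ : ℝ ↦ ∫ x, (Q x + δ ^ 2) ^ p ∂riemannianMeasure h) (𝓝[>] 0)
      (𝓝 (∫ x, Q x ^ p ∂riemannianMeasure h)) := by
  haveI := isFiniteMeasure_riemannianMeasure h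
  refine tendsto_integral_filter_of_dominated_convergence (fun x ↦ (Q x + 1) ^ p) ?_ ?_ ?_ ?_
  · exact Eventually.of_forall fun δ ↦
      ((hQ.add continuous_const).rpow_const fun x ↦ Or.inr hp).aestronglyMeasurable
  · have hI : Set.Ioo (0 : ℝ) 1 ∈ 𝓝[>] (0 : ℝ) := Ioo_mem_nhdsGT one_pos
    filter_upwards [hI] with δ hδ
    refine Eventually.of_forall fun x ↦ ?_
    have h0 : 0 ≤ Q x + δ ^ 2 := add_nonneg (hQ0 x) (sq_nonneg δ)
    rw [Real.norm_eq_abs, abs_of_nonneg (Real.rpow_nonneg h0 _)]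
    refine Real.rpow_le_rpow h0 ?_ hp
    nlinarith [hδ.1, hδ.2]
  · exact integrable_of_continuous h ((hQ.add continuous_const).rpow_const fun x ↦ Or.inr hp)
  · refine Eventually.of_forall fun x ↦ ?_
    have hc : ContinuousAt (fun δ : ℝ ↦ (Q x + δ ^ 2) ^ p) 0 :=
      ((continuous_const.add (continuous_pow 2)).rpow_const fun δ ↦ Or.inr hp).continuousAt
    have h0 : (fun δ : ℝ ↦ (Q x + δ ^ 2) ^ p) 0 = Q x ^ p := by simp
    rw [← h0]
    exact hc.tendsto.mono_left nhdsWithin_le_nhds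

variable [(ofRiemannian h).HasLeviCivita]

/-- **One step of Aubry's Moser iteration** (proof of Lemme 11 (i), third display, p. 394:
"En appliquant l'inégalité de Sobolev … à la fonction `u^p` et en faisant tendre `ε` vers `0`,
on obtient `‖S‖^p_{2pn/(n−2)} ≤ (C(n)p/√(2p−1)) (‖Δ_sph S‖_{2p} ‖S‖_{2p}^{2p−1})^{1/2} + ‖S‖^p_{2p}`").
Setting: a closed Riemannian `m`-manifold `(N, h)` with `Ric ≥ (m−1) h` on which the
**Sobolev inequality with constants `(A, 1)` and exponent `ν > 1`** holds for smooth functions,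
`‖v‖_{2ν} ≤ A ‖∇v‖₂ + ‖v‖₂` in the normalised norms `‖v‖_q = (⨍ |v|^q)^{1/q}`, `⨍ = (Vol N)⁻¹∫`
(hypothesis `hSob`; for `ν = n/(n−2)` and `A = C(n)` this is Ilias' inequality [Aubry's ref. 14]
under `Ric ≥ n − 1`, the INPUT of the printed proof). Then for every smooth `F`, with
`Q = |∇F|² + F² = |S_F|²`, `w = ΔF + mF`, `Q_w = |∇w|² + w²` and every real `p ≥ 1`:

  `(⨍ Q^{pν})^{1/(2ν)} ≤ A √( p²/(2p−1) · (⨍ Q_w^p)^{1/(2p)} (⨍ Q^p)^{(2p−1)/(2p)} ) + (⨍ Q^p)^{1/2}`,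

i.e. `‖S_F‖_{2pν}^p ≤ A p (2p−1)^{-1/2} ‖S_w‖_{2p}^{1/2} ‖S_F‖_{2p}^{p−1/2} + ‖S_F‖_{2p}^p`. Proof: the
Sobolev inequality for `u_δ^p`, `u_δ = √(Q + δ²)`; the energy inequality
`integral_gradSq_rpow_sqrt_le`; Hölder with exponents `2p, 2p/(2p−1)`; `δ → 0` by dominated
convergence. [cite: Aubry2005, §2, proof of Lemme 11 (i) (p. 394)] -/
theorem aubry_moser_step
    (hRic : ∀ (x : N) (v : TangentSpace I x),
      ((m : ℝ) - 1) * h.inner x v v ≤ (ofRiemannian h).ricci x v v)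
    {ν A : ℝ} (hν : 1 < ν) (hA : 0 ≤ A)
    (hSob : ∀ v : N → ℝ, ContMDiff I 𝓘(ℝ, ℝ) ∞ v →
      ((riemannianMeasure h univ).toReal⁻¹ * ∫ x, |v x| ^ (2 * ν) ∂riemannianMeasure h)
          ^ (1 / (2 * ν)) ≤
        A * Real.sqrt ((riemannianMeasure h univ).toReal⁻¹ *
              ∫ x, (ofRiemannian h).gradSq v x ∂riemannianMeasure h)
          + Real.sqrt ((riemannianMeasure h univ).toReal⁻¹ * ∫ x, v x ^ 2 ∂riemannianMeasure h))
    {F : N → ℝ} (hF : ContMDiff I 𝓘(ℝ, ℝ) ∞ F) {p : ℝ} (hp : 1 ≤ p) :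
    ((riemannianMeasure h univ).toReal⁻¹ *
        ∫ x, ((ofRiemannian h).gradSq F x + F x ^ 2) ^ (p * ν) ∂riemannianMeasure h) ^ (1 / (2 * ν)) ≤
      A * Real.sqrt (p ^ 2 / (2 * p - 1) *
            ((riemannianMeasure h univ).toReal⁻¹ *
              ∫ x, ((ofRiemannian h).gradSq
                  (fun y ↦ (ofRiemannian h).dalembertian F y + (m : ℝ) * F y) x
                + ((ofRiemannian h).dalembertian F x + (m : ℝ) * F x) ^ 2) ^ p
                ∂riemannianMeasure h) ^ (1 / (2 * p)) *
            ((riemannianMeasure h univ).toReal⁻¹ *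
              ∫ x, ((ofRiemannian h).gradSq F x + F x ^ 2) ^ p ∂riemannianMeasure h)
              ^ ((2 * p - 1) / (2 * p)))
        + Real.sqrt ((riemannianMeasure h univ).toReal⁻¹ *
            ∫ x, ((ofRiemannian h).gradSq F x + F x ^ 2) ^ p ∂riemannianMeasure h) := by
  have hg : (ofRiemannian h).IsRiemannian := isRiemannian_ofRiemannian h
  set V := (riemannianMeasure h univ).toReal with hVdef
  set Q : N → ℝ := fun x ↦ (ofRiemannian h).gradSq F x + F x ^ 2 with hQdef
  set w : N → ℝ := fun y ↦ (ofRiemannian h).dalembertian F y + (m : ℝ) * F y with hwdef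
  set Qw : N → ℝ := fun x ↦ (ofRiemannian h).gradSq w x + w x ^ 2 with hQwdef
  have hV0 : 0 ≤ V⁻¹ := inv_nonneg.2 ENNReal.toReal_nonneg
  have hp0 : 0 < p := by linarith
  have h2p : 0 < 2 * p - 1 := by linarith
  have hp12 : 1 / 2 < p := by linarith
  have hν0 : 0 < ν := by linarith
  have hpν : 0 < p * ν := mul_pos hp0 hν0
  have hgs0 : ∀ (G : N → ℝ) y, 0 ≤ (ofRiemannian h).gradSq G y := fun G y ↦ by
    rw [PseudoRiemannianMetric.gradSq, innerDual_eq_val_sharp_sharp]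
    exact (ofRiemannian h).val_self_nonneg' y hg _
  have hQ0 : ∀ x, 0 ≤ Q x := fun x ↦ add_nonneg (hgs0 F x) (sq_nonneg _)
  have hQw0 : ∀ x, 0 ≤ Qw x := fun x ↦ add_nonneg (hgs0 w x) (sq_nonneg _)
  have hQs : ContMDiff I 𝓘(ℝ, ℝ) ∞ Q :=
    (contMDiff_gradSq _ hF).add ((contDiff_id.pow 2).comp_contMDiff hF)
  have hws : ContMDiff I 𝓘(ℝ, ℝ) ∞ w :=
    (contMDiff_dalembertian _ hF).add (contMDiff_const.mul hF)
  have hQws : ContMDiff I 𝓘(ℝ, ℝ) ∞ Qw :=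
    (contMDiff_gradSq _ hws).add ((contDiff_id.pow 2).comp_contMDiff hws)
  -- the Hölder exponents `2p` and `2p/(2p-1)`
  have hab : (2 * p).HolderConjugate (2 * p / (2 * p - 1)) := by
    rw [Real.holderConjugate_iff]
    refine ⟨by linarith, ?_⟩
    field_simp
    ring
  -- constants of the right-hand side
  set M := (V⁻¹ * ∫ x, Qw x ^ p ∂riemannianMeasure h) ^ (1 / (2 * p)) with hMdef
  have hM0 : 0 ≤ M := Real.rpow_nonneg (mul_nonneg hV0 (integral_nonneg fun x ↦
    Real.rpow_nonneg (hQw0 x) _)) _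
  set T : ℝ → ℝ := fun δ ↦ V⁻¹ * ∫ x, (Q x + δ ^ 2) ^ p ∂riemannianMeasure h with hTdef
  have hT0 : ∀ δ, 0 ≤ T δ := fun δ ↦ mul_nonneg hV0 (integral_nonneg fun x ↦
    Real.rpow_nonneg (add_nonneg (hQ0 x) (sq_nonneg δ)) _)
  set Φ : ℝ → ℝ := fun t ↦ A * Real.sqrt (p ^ 2 / (2 * p - 1) * M * t ^ ((2 * p - 1) / (2 * p)))
    + Real.sqrt t with hΦdef
  -- STEP 1: the inequality for every `δ ∈ (0, 1)`
  have hstep : ∀ δ : ℝ, 0 < δ →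
      (V⁻¹ * ∫ x, Q x ^ (p * ν) ∂riemannianMeasure h) ^ (1 / (2 * ν)) ≤ Φ (T δ) := by
    intro δ hδ
    set u : N → ℝ := fun y ↦ Real.sqrt (Q y + δ ^ 2) with hudef
    have hus : ContMDiff I 𝓘(ℝ, ℝ) ∞ u := contMDiff_sqrt_gradSq_add_sq _ hg hF hδ
    have hupos : ∀ y, 0 < u y := fun y ↦
      Real.sqrt_pos.2 (add_pos_of_nonneg_of_pos (hQ0 y) (pow_pos hδ 2))
    have hup : ContMDiff I 𝓘(ℝ, ℝ) ∞ (fun y ↦ u y ^ p) := contMDiff_rpow_of_pos hus hupos p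
    -- powers of `u`
    have hsqrt_rpow : ∀ {t : ℝ}, 0 ≤ t → ∀ s : ℝ, Real.sqrt t ^ s = t ^ (s / 2) := by
      intro t ht s
      rw [Real.sqrt_eq_rpow, ← Real.rpow_mul ht]
      congr 1
      ring
    have hupow : ∀ y (s : ℝ), u y ^ s = (Q y + δ ^ 2) ^ (s / 2) := fun y s ↦
      hsqrt_rpow (add_nonneg (hQ0 y) (sq_nonneg δ)) s
    -- (a) the Sobolev inequality for `u^p`
    have hS := hSob (fun y ↦ u y ^ p) hup
    have hSl : (V⁻¹ * ∫ x, |u x ^ p| ^ (2 * ν) ∂riemannianMeasure h) =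
        V⁻¹ * ∫ x, (Q x + δ ^ 2) ^ (p * ν) ∂riemannianMeasure h := by
      congr 1
      refine integral_congr_ae (Eventually.of_forall fun x ↦ ?_)
      dsimp only
      rw [abs_of_nonneg (Real.rpow_nonneg (hupos x).le _), ← Real.rpow_mul (hupos x).le, hupow]
      congr 1
      ring
    have hS2 : (V⁻¹ * ∫ x, (u x ^ p) ^ 2 ∂riemannianMeasure h) = T δ := by
      simp only [hTdef]
      congr 1
      refine integral_congr_ae (Eventually.of_forall fun x ↦ ?_)
      dsimp only
      rw [← Real.rpow_natCast, ← Real.rpow_mul (hupos x).le, hupow]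
      congr 1
      push_cast
      ring
    rw [hSl, hS2] at hS
    -- (b) the left-hand side dominates the `δ = 0` quantity
    have hLHS : (V⁻¹ * ∫ x, Q x ^ (p * ν) ∂riemannianMeasure h) ^ (1 / (2 * ν)) ≤
        (V⁻¹ * ∫ x, (Q x + δ ^ 2) ^ (p * ν) ∂riemannianMeasure h) ^ (1 / (2 * ν)) := by
      refine Real.rpow_le_rpow (mul_nonneg hV0 (integral_nonneg fun x ↦
        Real.rpow_nonneg (hQ0 x) _)) ?_ (one_div_nonneg.2 (by linarith))
      refine mul_le_mul_of_nonneg_left ?_ hV0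
      refine integral_mono ?_ ?_ fun x ↦ ?_
      · exact integrable_of_continuous h (hQs.continuous.rpow_const fun x ↦ Or.inr hpν.le)
      · exact integrable_of_continuous h ((hQs.continuous.add continuous_const).rpow_const
          fun x ↦ Or.inr hpν.le)
      · exact Real.rpow_le_rpow (hQ0 x) (by nlinarith) hpν.le
    -- (c) the energy term: `⨍ |∇(u^p)|² ≤ p²/(2p-1) ⨍ √Q_w u^{2p-1} ≤ p²/(2p-1) M T(δ)^{(2p-1)/(2p)}`
    have hE := integral_gradSq_rpow_sqrt_le h hRic hF hδ hp12
    have hHo := normalized_holder h (f := fun x ↦ Real.sqrt (Qw x)) (g := fun x ↦ u x ^ (2 * p - 1))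
      (Real.continuous_sqrt.comp hQws.continuous) (contMDiff_rpow_of_pos hus hupos _).continuous
      (fun x ↦ Real.sqrt_nonneg _) (fun x ↦ Real.rpow_nonneg (hupos x).le _) hab
    have hHo1 : (V⁻¹ * ∫ x, Real.sqrt (Qw x) ^ (2 * p) ∂riemannianMeasure h) ^ (1 / (2 * p)) = M := by
      simp only [hMdef]
      congr 2
      refine integral_congr_ae (Eventually.of_forall fun x ↦ ?_)
      dsimp only
      rw [hsqrt_rpow (hQw0 x)]
      congr 1
      ring
    have hHo2 : (V⁻¹ * ∫ x, (u x ^ (2 * p - 1)) ^ (2 * p / (2 * p - 1)) ∂riemannianMeasure h)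
        ^ (1 / (2 * p / (2 * p - 1))) = T δ ^ ((2 * p - 1) / (2 * p)) := by
      have he : 1 / (2 * p / (2 * p - 1)) = (2 * p - 1) / (2 * p) := by
        field_simp
      rw [he]
      simp only [hTdef]
      congr 2
      refine integral_congr_ae (Eventually.of_forall fun x ↦ ?_)
      dsimp only
      rw [← Real.rpow_mul (hupos x).le, hupow]
      congr 1
      field_simp
    rw [hHo1, hHo2] at hHo
    have hEn : V⁻¹ * ∫ x, (ofRiemannian h).gradSq (fun y ↦ u y ^ p) x ∂riemannianMeasure h ≤
        p ^ 2 / (2 * p - 1) * M * T δ ^ ((2 * p - 1) / (2 * p)) := by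
      have h1 : V⁻¹ * ∫ x, (ofRiemannian h).gradSq (fun y ↦ u y ^ p) x ∂riemannianMeasure h ≤
          V⁻¹ * (p ^ 2 / (2 * p - 1) * ∫ x, Real.sqrt (Qw x) * u x ^ (2 * p - 1)
            ∂riemannianMeasure h) := mul_le_mul_of_nonneg_left hE hV0
      have h2 : V⁻¹ * (p ^ 2 / (2 * p - 1) * ∫ x, Real.sqrt (Qw x) * u x ^ (2 * p - 1)
            ∂riemannianMeasure h) = p ^ 2 / (2 * p - 1) * (V⁻¹ * ∫ x, Real.sqrt (Qw x) *
              u x ^ (2 * p - 1) ∂riemannianMeasure h) := by ring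
      rw [h2] at h1
      have h3 := mul_le_mul_of_nonneg_left hHo (div_nonneg (sq_nonneg p) h2p.le)
      linarith
    -- (d) assemble
    calc (V⁻¹ * ∫ x, Q x ^ (p * ν) ∂riemannianMeasure h) ^ (1 / (2 * ν))
        ≤ (V⁻¹ * ∫ x, (Q x + δ ^ 2) ^ (p * ν) ∂riemannianMeasure h) ^ (1 / (2 * ν)) := hLHS
      _ ≤ A * Real.sqrt (V⁻¹ * ∫ x, (ofRiemannian h).gradSq (fun y ↦ u y ^ p) x
            ∂riemannianMeasure h) + Real.sqrt (T δ) := hS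
      _ ≤ Φ (T δ) := by
          simp only [hΦdef]
          gcongr
  -- STEP 2: `δ → 0⁺`
  have hT : Tendsto T (𝓝[>] 0) (𝓝 (V⁻¹ * ∫ x, Q x ^ p ∂riemannianMeasure h)) :=
    (tendsto_integral_add_sq_rpow h hQs.continuous hQ0 hp0.le).const_mul V⁻¹
  have hΦc : Continuous Φ := by
    refine (continuous_const.mul (Real.continuous_sqrt.comp ?_)).add Real.continuous_sqrt
    exact continuous_const.mul (continuous_id.rpow_const fun t ↦
      Or.inr (div_nonneg h2p.le (by linarith)))
  have hlim : Tendsto (fun δ ↦ Φ (T δ)) (𝓝[>] 0)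
      (𝓝 (Φ (V⁻¹ * ∫ x, Q x ^ p ∂riemannianMeasure h))) :=
    (hΦc.tendsto _).comp hT
  have hev : ∀ᶠ δ in 𝓝[>] (0 : ℝ),
      (V⁻¹ * ∫ x, Q x ^ (p * ν) ∂riemannianMeasure h) ^ (1 / (2 * ν)) ≤ Φ (T δ) := by
    filter_upwards [self_mem_nhdsWithin] with δ hδ
    exact hstep δ hδ
  exact ge_of_tendsto hlim hev

end MoserStep

/-! ### Part C4 — the span of pinched eigenfunctions: `L²` Gram identity and the iteration -/

section EigenSpan

variable {m : ℕ} {H : Type*} [TopologicalSpace H]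
  {I : ModelWithCorners ℝ (EuclideanSpace ℝ (Fin m)) H} [I.Boundaryless]
  {N : Type*} [TopologicalSpace N] [ChartedSpace H N] [IsManifold I ∞ N] [CompactSpace N]
  [T2Space N] [MeasurableSpace N] [BorelSpace N]
  (h : ContMDiffRiemannianMetric I ∞ (EuclideanSpace ℝ (Fin m)) (TangentSpace I : N → Type _))
  [(ofRiemannian h).HasLeviCivita]
  {k : ℕ} {f : Fin k → N → ℝ} {μ : Fin k → ℝ}

omit [I.Boundaryless] [CompactSpace N] [T2Space N] [MeasurableSpace N] [BorelSpace N]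
  [IsManifold I ∞ N] in
/-- Linear combinations of smooth functions are smooth. [folklore] -/
theorem contMDiff_linComb (hf : ∀ i, ContMDiff I 𝓘(ℝ, ℝ) ∞ (f i)) (α : Fin k → ℝ) :
    ContMDiff I 𝓘(ℝ, ℝ) ∞ (fun x ↦ ∑ i, α i * f i x) := fun x ↦
  contMDiffAt_finsetSum fun i _ ↦ (contMDiff_const.mul (hf i)) x

omit [CompactSpace N] [T2Space N] [MeasurableSpace N] [BorelSpace N] in
/-- **`Δ` of a linear combination of eigenfunctions**: if `Δ_h fᵢ = −μᵢ fᵢ` then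
`Δ_h (Σ αᵢ fᵢ) = −Σ αᵢ μᵢ fᵢ`. [cite: Aubry2005, §2 (p. 393)] -/
theorem dalembertian_linComb (hf : ∀ i, ContMDiff I 𝓘(ℝ, ℝ) ∞ (f i))
    (hΔ : ∀ (i : Fin k) (x : N), (ofRiemannian h).dalembertian (f i) x = -(μ i) * f i x)
    (α : Fin k → ℝ) (x : N) :
    (ofRiemannian h).dalembertian (fun y ↦ ∑ i, α i * f i y) x = -∑ i, α i * μ i * f i x := by
  have h2 : (2 : ℕ∞ω) ≤ ∞ := WithTop.coe_le_coe.mpr le_top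
  have hf2 : ∀ i y, ContMDiffAt I 𝓘(ℝ, ℝ) 2 (f i) y := fun i y ↦ ((hf i).of_le h2).contMDiffAt
  have hcf2 : ∀ i y, ContMDiffAt I 𝓘(ℝ, ℝ) 2 (fun y ↦ α i * f i y) y := fun i y ↦
    (((contMDiff_const (c := α i)).mul (hf i)).of_le h2).contMDiffAt
  rw [KarpukhinStern.dalembertian_finset_sum (ofRiemannian h) Finset.univ (fun i _ ↦ hcf2 i x),
    ← Finset.sum_neg_distrib]
  refine Finset.sum_congr rfl fun i _ ↦ ?_
  have hfun : (fun y ↦ α i * f i y) = fun y ↦ (fun _ : N ↦ (0 : ℝ)) y + α i * f i y := by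
    funext y; simp
  rw [hfun, dalembertian_add_const_mul (ofRiemannian h) (α i) contMDiffAt_const (hf2 i x),
    KarpukhinStern.dalembertian_const_fun, hΔ i x]
  ring

omit [CompactSpace N] [T2Space N] [MeasurableSpace N] [BorelSpace N] in
/-- **`w = ΔF + mF` stays in the span**: for `F = Σ αᵢ fᵢ`, `Δ_h F + m F = Σ (m − μᵢ) αᵢ fᵢ` — the
function form of Lemme 8, `Δ^E_sph S_{fᵢ} = (λᵢ − n) A S_{fᵢ}` (p. 391).
[cite: Aubry2005, §2, Lemme 8 (p. 391)] -/
theorem dalembertian_linComb_add_eq (hf : ∀ i, ContMDiff I 𝓘(ℝ, ℝ) ∞ (f i))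
    (hΔ : ∀ (i : Fin k) (x : N), (ofRiemannian h).dalembertian (f i) x = -(μ i) * f i x)
    (α : Fin k → ℝ) :
    (fun y ↦ (ofRiemannian h).dalembertian (fun z ↦ ∑ i, α i * f i z) y
        + (m : ℝ) * ∑ i, α i * f i y) =
      fun y ↦ ∑ i, (((m : ℝ) - μ i) * α i) * f i y := by
  funext y
  rw [dalembertian_linComb h hf hΔ α y, Finset.mul_sum, ← Finset.sum_neg_distrib,
    ← Finset.sum_add_distrib]
  refine Finset.sum_congr rfl fun i _ ↦ ?_
  ring

omit [I.Boundaryless] [(ofRiemannian h).HasLeviCivita] in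
/-- **`L²` products in an orthonormal family**: `∫ (Σ αᵢfᵢ)(Σ βⱼfⱼ) dμ = Σ αᵢβᵢ`. [folklore] -/
theorem integral_linComb_mul_linComb (hf : ∀ i, ContMDiff I 𝓘(ℝ, ℝ) ∞ (f i))
    (horth : ∀ i j, ∫ x, f i x * f j x ∂riemannianMeasure h = if i = j then 1 else 0)
    (α β : Fin k → ℝ) :
    ∫ x, (∑ i, α i * f i x) * (∑ j, β j * f j x) ∂riemannianMeasure h = ∑ i, α i * β i := by
  have hc : ∀ i, Continuous (f i) := fun i ↦ (hf i).continuous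
  have hint : ∀ i j, Integrable (fun x ↦ α i * f i x * (β j * f j x)) (riemannianMeasure h) :=
    fun i j ↦ integrable_of_continuous h
      ((continuous_const.mul (hc i)).mul (continuous_const.mul (hc j)))
  calc ∫ x, (∑ i, α i * f i x) * (∑ j, β j * f j x) ∂riemannianMeasure h
      = ∫ x, ∑ i, ∑ j, α i * f i x * (β j * f j x) ∂riemannianMeasure h := by
        congr 1; funext x; rw [Finset.sum_mul_sum]
    _ = ∑ i, ∑ j, ∫ x, α i * f i x * (β j * f j x) ∂riemannianMeasure h := by
        rw [integral_finsetSum _ (fun i _ ↦ integrable_finsetSum _ (fun j _ ↦ hint i j))]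
        refine Finset.sum_congr rfl fun i _ ↦ ?_
        rw [integral_finsetSum _ (fun j _ ↦ hint i j)]
    _ = ∑ i, ∑ j, α i * β j * (if i = j then 1 else 0) := by
        refine Finset.sum_congr rfl fun i _ ↦ Finset.sum_congr rfl fun j _ ↦ ?_
        rw [← horth i j, ← integral_const_mul]
        congr 1; funext x; ring
    _ = ∑ i, α i * β i := by
        refine Finset.sum_congr rfl fun i _ ↦ ?_
        simp only [mul_ite, mul_one, mul_zero, Finset.sum_ite_eq, Finset.mem_univ, if_true]

/-- **The `L²`-norm of `S_F` on the span** (Aubry 2005, p. 394: the family `(Sᵢ/√(λᵢ+1))` is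
`L²`-orthonormal): for `F = Σ αᵢ fᵢ` with `Δ fᵢ = −μᵢ fᵢ` and `(fᵢ)` `L²(dμ_h)`-orthonormal,
`∫ (|∇F|² + F²) dμ_h = Σ αᵢ² (μᵢ + 1)`. [cite: Aubry2005, §2, proof of Lemme 11 (p. 394)] -/
theorem integral_gradSq_add_sq_linComb (hf : ∀ i, ContMDiff I 𝓘(ℝ, ℝ) ∞ (f i))
    (hΔ : ∀ (i : Fin k) (x : N), (ofRiemannian h).dalembertian (f i) x = -(μ i) * f i x)
    (horth : ∀ i j, ∫ x, f i x * f j x ∂riemannianMeasure h = if i = j then 1 else 0)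
    (α : Fin k → ℝ) :
    ∫ x, ((ofRiemannian h).gradSq (fun y ↦ ∑ i, α i * f i y) x + (∑ i, α i * f i x) ^ 2)
        ∂riemannianMeasure h = ∑ i, α i ^ 2 * (μ i + 1) := by
  have hFs := contMDiff_linComb hf α
  have hGreen := integral_mul_dalembertian_eq_neg_integral_innerDual h
    (u := fun y ↦ ∑ i, α i * f i y) (f := fun y ↦ ∑ i, α i * f i y)
    (hFs.of_le (by exact_mod_cast le_top)) (hFs.of_le (WithTop.coe_le_coe.mpr le_top))
  have h1 : ∫ x, (ofRiemannian h).gradSq (fun y ↦ ∑ i, α i * f i y) x ∂riemannianMeasure h =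
      ∑ i, α i * (α i * μ i) := by
    have hg : ∫ x, (ofRiemannian h).gradSq (fun y ↦ ∑ i, α i * f i y) x ∂riemannianMeasure h =
        ∫ x, (ofRiemannian h).innerDual x (mvfderiv I (fun y ↦ ∑ i, α i * f i y) x).toLinearMap
          (mvfderiv I (fun y ↦ ∑ i, α i * f i y) x).toLinearMap ∂riemannianMeasure h := rfl
    rw [hg, ← neg_eq_iff_eq_neg.2 hGreen]
    simp_rw [dalembertian_linComb h hf hΔ α, mul_neg, integral_neg, neg_neg]
    exact integral_linComb_mul_linComb h hf horth α (fun i ↦ α i * μ i)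
  have h2 : ∫ x, (∑ i, α i * f i x) ^ 2 ∂riemannianMeasure h = ∑ i, α i * α i := by
    simp_rw [sq]
    exact integral_linComb_mul_linComb h hf horth α α
  have iQ : Integrable (fun x ↦ (ofRiemannian h).gradSq (fun y ↦ ∑ i, α i * f i y) x)
      (riemannianMeasure h) := integrable_of_continuous h (contMDiff_gradSq _ hFs).continuous
  have iF : Integrable (fun x ↦ (∑ i, α i * f i x) ^ 2) (riemannianMeasure h) :=
    integrable_of_continuous h (hFs.continuous.pow 2)
  rw [integral_add iQ iF, h1, h2, ← Finset.sum_add_distrib]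
  refine Finset.sum_congr rfl fun i _ ↦ ?_
  ring

omit [TopologicalSpace H] in
/-- The coefficient estimate `Σ ((m−μᵢ)αᵢ)²(μᵢ+1) ≤ ε² Σ αᵢ²(μᵢ+1)` under the two-sided pinching
`m ≤ μᵢ ≤ m + ε` — i.e. `‖A Δ^E_sph S‖₂ ≤ (λ_k − n) ‖S‖₂` (p. 394). [cite: Aubry2005, §2, proof of Lemme 11 (p. 394)] -/
theorem sum_pinched_coeff_le {ε : ℝ} (hμ : ∀ i, (m : ℝ) ≤ μ i ∧ μ i ≤ m + ε) (α : Fin k → ℝ) :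
    ∑ i, (((m : ℝ) - μ i) * α i) ^ 2 * (μ i + 1) ≤ ε ^ 2 * ∑ i, α i ^ 2 * (μ i + 1) := by
  rw [Finset.mul_sum]
  refine Finset.sum_le_sum fun i _ ↦ ?_
  have hm : (0 : ℝ) ≤ m := Nat.cast_nonneg m
  have h1 : ((m : ℝ) - μ i) ^ 2 ≤ ε ^ 2 := by nlinarith [(hμ i).1, (hμ i).2]
  have h2 : 0 ≤ α i ^ 2 * (μ i + 1) := mul_nonneg (sq_nonneg _) (by linarith [(hμ i).1])
  nlinarith

/-- **The product of the Moser iteration is bounded** (Aubry 2005, p. 394: "en utilisant la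
concavité de la fonction `log`, on obtient `A_∞ ≤ (1 + C(n)√ε)`"): for `ν > 1`, `a ≥ 0`,

  `∏_{i<j} (1 + a νⁱ/√(2νⁱ−1))^{1/νⁱ} ≤ exp( a / (1 − 1/√ν) )`

(`(1+y)^t ≤ e^{yt}`, `1/√(2νⁱ−1) ≤ ν^{−i/2}`, geometric series).
[cite: Aubry2005, §2, proof of Lemme 11 (i) (p. 394)] -/
theorem moser_product_le {ν : ℝ} (hν : 1 < ν) {a : ℝ} (ha : 0 ≤ a) (j : ℕ) :
    ∏ i ∈ Finset.range j, (1 + a * (ν ^ i / Real.sqrt (2 * ν ^ i - 1))) ^ ((ν ^ i)⁻¹ : ℝ) ≤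
      Real.exp (a / (1 - (Real.sqrt ν)⁻¹)) := by
  have hν0 : 0 < ν := by linarith
  set r := (Real.sqrt ν)⁻¹ with hr
  have hsν : 1 < Real.sqrt ν := by
    rw [show (1 : ℝ) = Real.sqrt 1 from Real.sqrt_one.symm]
    exact Real.sqrt_lt_sqrt zero_le_one hν
  have hr0 : 0 ≤ r := inv_nonneg.2 (Real.sqrt_nonneg _)
  have hr1 : r < 1 := inv_lt_one_of_one_lt₀ hsν
  -- the `i`-th factor is at most `exp (a rⁱ)`
  have hfac : ∀ i, (1 + a * (ν ^ i / Real.sqrt (2 * ν ^ i - 1))) ^ ((ν ^ i)⁻¹ : ℝ) ≤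
      Real.exp (a * r ^ i) := by
    intro i
    have hνi : 1 ≤ ν ^ i := one_le_pow₀ hν.le
    have hνi0 : 0 < ν ^ i := by positivity
    have h21 : 0 < 2 * ν ^ i - 1 := by linarith
    have hy : 0 ≤ a * (ν ^ i / Real.sqrt (2 * ν ^ i - 1)) := by positivity
    calc (1 + a * (ν ^ i / Real.sqrt (2 * ν ^ i - 1))) ^ ((ν ^ i)⁻¹ : ℝ)
        ≤ Real.exp (a * (ν ^ i / Real.sqrt (2 * ν ^ i - 1))) ^ ((ν ^ i)⁻¹ : ℝ) := by
          refine Real.rpow_le_rpow (by linarith) ?_ (inv_nonneg.2 hνi0.le)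
          linarith [Real.add_one_le_exp (a * (ν ^ i / Real.sqrt (2 * ν ^ i - 1)))]
      _ = Real.exp (a * (1 / Real.sqrt (2 * ν ^ i - 1))) := by
          rw [← Real.exp_mul]
          congr 1
          field_simp
      _ ≤ Real.exp (a * r ^ i) := by
          refine Real.exp_le_exp.2 (mul_le_mul_of_nonneg_left ?_ ha)
          have hpos : 0 < Real.sqrt ν ^ i := pow_pos (by positivity) i
          rw [hr, inv_pow, one_div]
          refine (inv_le_inv₀ (Real.sqrt_pos.2 h21) hpos).2 ?_
          refine (Real.le_sqrt (pow_nonneg (Real.sqrt_nonneg ν) i) h21.le).2 ?_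
          rw [← pow_mul, mul_comm, pow_mul, Real.sq_sqrt hν0.le]
          linarith
  have hfac0 : ∀ i, 0 ≤ (1 + a * (ν ^ i / Real.sqrt (2 * ν ^ i - 1))) ^ ((ν ^ i)⁻¹ : ℝ) := by
    intro i
    refine Real.rpow_nonneg ?_ _
    have := mul_nonneg ha (div_nonneg (pow_nonneg hν0.le i) (Real.sqrt_nonneg (2 * ν ^ i - 1)))
    linarith
  calc ∏ i ∈ Finset.range j, (1 + a * (ν ^ i / Real.sqrt (2 * ν ^ i - 1))) ^ ((ν ^ i)⁻¹ : ℝ)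
      ≤ ∏ i ∈ Finset.range j, Real.exp (a * r ^ i) :=
        Finset.prod_le_prod (fun i _ ↦ hfac0 i) (fun i _ ↦ hfac i)
    _ = Real.exp (∑ i ∈ Finset.range j, a * r ^ i) := (Real.exp_sum _ _).symm
    _ ≤ Real.exp (a / (1 - r)) := by
        refine Real.exp_le_exp.2 ?_
        rw [← Finset.mul_sum]
        have hgeom : ∑ i ∈ Finset.range j, r ^ i ≤ 1 / (1 - r) := by
          rw [geom_sum_eq hr1.ne j, show (r ^ j - 1) / (r - 1) = (1 - r ^ j) / (1 - r) by
            rw [div_eq_div_iff (sub_ne_zero.2 hr1.ne) (sub_ne_zero.2 (ne_of_gt hr1))]; ring]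
          exact div_le_div_of_nonneg_right (by linarith [pow_nonneg hr0 j]) (by linarith)
        calc a * ∑ i ∈ Finset.range j, r ^ i ≤ a * (1 / (1 - r)) :=
              mul_le_mul_of_nonneg_left hgeom ha
          _ = a / (1 - r) := by ring

/-- **Aubry's Moser iteration on the span of pinched eigenfunctions** (proof of Lemme 11 (i),
p. 394: "`A_{2pn/(n−2)} ≤ (1 + C(n)p(2p−1)^{−1/2}(λ_k − n)^{1/2})^{1/p} A_{2p}`, et donc
`A_∞ ≤ ∏_j (1 + C(n)νʲ(2νʲ−1)^{−1/2}(λ_k−n)^{1/2})^{1/νʲ}`"). Setting: a closed Riemannian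
`m`-manifold `(N, h)` with `Ric ≥ (m − 1) h` satisfying the Sobolev inequality `hSob` with
constants `(A, 1)` and exponent `ν > 1` (normalised norms); `f₁, …, f_k` smooth,
`L²(dμ_h)`-orthonormal, `Δ_h fᵢ = −μᵢ fᵢ` with the two-sided pinching `m ≤ μᵢ ≤ m + ε`. Then for
every `α ∈ ℝᵏ` and `j ∈ ℕ`, with `F_α = Σ αᵢ fᵢ` and `|S_α|² = |∇F_α|² + F_α²`,

  `‖S_α‖_{2νʲ} = (⨍ |S_α|^{2νʲ})^{1/(2νʲ)} ≤ K_j ‖S_α‖₂`,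
  `K_j = ∏_{i<j} (1 + A√ε νⁱ/√(2νⁱ−1))^{1/νⁱ}`,  `‖S_α‖₂² = ⨍|S_α|² = (Vol N)⁻¹ Σ αᵢ²(μᵢ+1)`.

Induction on `j`: the step is `aubry_moser_step` for `F_α` with `p = νʲ`, in which
`w = ΔF_α + mF_α = F_β`, `βᵢ = (m − μᵢ)αᵢ`, has `‖S_β‖₂ ≤ ε‖S_α‖₂` (`sum_pinched_coeff_le`) and, by
the induction hypothesis applied to `β` and to `α`, `‖S_β‖_{2p} ≤ K_j ε ‖S_α‖₂`,
`‖S_α‖_{2p} ≤ K_j ‖S_α‖₂`. [cite: Aubry2005, §2, proof of Lemme 11 (i) (p. 394)] -/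
theorem aubry_moser_iterate
    (hRic : ∀ (x : N) (v : TangentSpace I x),
      ((m : ℝ) - 1) * h.inner x v v ≤ (ofRiemannian h).ricci x v v)
    {ν A ε : ℝ} (hν : 1 < ν) (hA : 0 ≤ A) (hε : 0 ≤ ε)
    (hSob : ∀ v : N → ℝ, ContMDiff I 𝓘(ℝ, ℝ) ∞ v →
      ((riemannianMeasure h univ).toReal⁻¹ * ∫ x, |v x| ^ (2 * ν) ∂riemannianMeasure h)
          ^ (1 / (2 * ν)) ≤
        A * Real.sqrt ((riemannianMeasure h univ).toReal⁻¹ *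
              ∫ x, (ofRiemannian h).gradSq v x ∂riemannianMeasure h)
          + Real.sqrt ((riemannianMeasure h univ).toReal⁻¹ * ∫ x, v x ^ 2 ∂riemannianMeasure h))
    (hf : ∀ i, ContMDiff I 𝓘(ℝ, ℝ) ∞ (f i))
    (hΔ : ∀ (i : Fin k) (x : N), (ofRiemannian h).dalembertian (f i) x = -(μ i) * f i x)
    (hμ : ∀ i, (m : ℝ) ≤ μ i ∧ μ i ≤ m + ε)
    (horth : ∀ i j, ∫ x, f i x * f j x ∂riemannianMeasure h = if i = j then 1 else 0)
    (j : ℕ) (α : Fin k → ℝ) :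
    ((riemannianMeasure h univ).toReal⁻¹ *
        ∫ x, ((ofRiemannian h).gradSq (fun y ↦ ∑ i, α i * f i y) x + (∑ i, α i * f i x) ^ 2)
          ^ (ν ^ j) ∂riemannianMeasure h) ^ (1 / (2 * ν ^ j)) ≤
      (∏ i ∈ Finset.range j, (1 + A * Real.sqrt ε * (ν ^ i / Real.sqrt (2 * ν ^ i - 1)))
          ^ ((ν ^ i)⁻¹ : ℝ)) *
        Real.sqrt ((riemannianMeasure h univ).toReal⁻¹ * ∑ i, α i ^ 2 * (μ i + 1)) := by
  have hg : (ofRiemannian h).IsRiemannian := isRiemannian_ofRiemannian h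
  set V := (riemannianMeasure h univ).toReal with hVdef
  have hV0 : 0 ≤ V⁻¹ := inv_nonneg.2 ENNReal.toReal_nonneg
  have hν0 : 0 < ν := by linarith
  have hgs0 : ∀ (G : N → ℝ) y, 0 ≤ (ofRiemannian h).gradSq G y := fun G y ↦ by
    rw [PseudoRiemannianMetric.gradSq, innerDual_eq_val_sharp_sharp]
    exact (ofRiemannian h).val_self_nonneg' y hg _
  -- `‖S_γ‖₂² = V⁻¹ Σ γᵢ²(μᵢ+1) ≥ 0`
  have hS0 : ∀ γ : Fin k → ℝ, 0 ≤ V⁻¹ * ∑ i, γ i ^ 2 * (μ i + 1) := fun γ ↦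
    mul_nonneg hV0 (Finset.sum_nonneg fun i _ ↦ mul_nonneg (sq_nonneg _) (by linarith [(hμ i).1]))
  induction j generalizing α with
  | zero =>
    simp only [pow_zero, mul_one, Finset.range_zero, Finset.prod_empty, one_mul, Real.rpow_one]
    rw [integral_gradSq_add_sq_linComb h hf hΔ horth α, Real.sqrt_eq_rpow]
  | succ j ih =>
    -- notation
    set p : ℝ := ν ^ j with hpdef
    have hp : 1 ≤ p := one_le_pow₀ hν.le
    have hp0 : 0 < p := by linarith
    have h2p : 0 < 2 * p - 1 := by linarith
    set β : Fin k → ℝ := fun i ↦ ((m : ℝ) - μ i) * α i with hβdef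
    set Qα : N → ℝ := fun x ↦ (ofRiemannian h).gradSq (fun y ↦ ∑ i, α i * f i y) x
      + (∑ i, α i * f i x) ^ 2 with hQαdef
    set Qβ : N → ℝ := fun x ↦ (ofRiemannian h).gradSq (fun y ↦ ∑ i, β i * f i y) x
      + (∑ i, β i * f i x) ^ 2 with hQβdef
    have hQα0 : ∀ x, 0 ≤ Qα x := fun x ↦ add_nonneg (hgs0 _ x) (sq_nonneg _)
    have hQβ0 : ∀ x, 0 ≤ Qβ x := fun x ↦ add_nonneg (hgs0 _ x) (sq_nonneg _)
    set K : ℝ := ∏ i ∈ Finset.range j,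
      (1 + A * Real.sqrt ε * (ν ^ i / Real.sqrt (2 * ν ^ i - 1))) ^ ((ν ^ i)⁻¹ : ℝ) with hKdef
    have hK0 : 0 ≤ K := Finset.prod_nonneg fun i _ ↦ Real.rpow_nonneg (by
      have := mul_nonneg (mul_nonneg hA (Real.sqrt_nonneg ε))
        (div_nonneg (pow_nonneg hν0.le i) (Real.sqrt_nonneg (2 * ν ^ i - 1)))
      linarith) _
    set s₀ := Real.sqrt (V⁻¹ * ∑ i, α i ^ 2 * (μ i + 1)) with hs₀def
    have hs₀0 : 0 ≤ s₀ := Real.sqrt_nonneg _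
    set X := K * s₀ with hXdef
    have hX0 : 0 ≤ X := mul_nonneg hK0 hs₀0
    set G : ℝ := 1 + A * Real.sqrt ε * (p / Real.sqrt (2 * p - 1)) with hGdef
    have hG1 : 1 ≤ G := by
      have := mul_nonneg (mul_nonneg hA (Real.sqrt_nonneg ε))
        (div_nonneg hp0.le (Real.sqrt_nonneg (2 * p - 1)))
      linarith
    have hG0 : 0 ≤ G := by linarith
    -- the induction hypotheses for `α` and `β`
    set nα := (V⁻¹ * ∫ x, Qα x ^ p ∂riemannianMeasure h) ^ (1 / (2 * p)) with hnαdef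
    set nβ := (V⁻¹ * ∫ x, Qβ x ^ p ∂riemannianMeasure h) ^ (1 / (2 * p)) with hnβdef
    have hTα0 : 0 ≤ V⁻¹ * ∫ x, Qα x ^ p ∂riemannianMeasure h :=
      mul_nonneg hV0 (integral_nonneg fun x ↦ Real.rpow_nonneg (hQα0 x) _)
    have hTβ0 : 0 ≤ V⁻¹ * ∫ x, Qβ x ^ p ∂riemannianMeasure h :=
      mul_nonneg hV0 (integral_nonneg fun x ↦ Real.rpow_nonneg (hQβ0 x) _)
    have hnα0 : 0 ≤ nα := Real.rpow_nonneg hTα0 _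
    have hnβ0 : 0 ≤ nβ := Real.rpow_nonneg hTβ0 _
    have ihα : nα ≤ X := ih α
    have hs₀β : Real.sqrt (V⁻¹ * ∑ i, β i ^ 2 * (μ i + 1)) ≤ ε * s₀ := by
      have h1 : V⁻¹ * ∑ i, β i ^ 2 * (μ i + 1) ≤ V⁻¹ * (ε ^ 2 * ∑ i, α i ^ 2 * (μ i + 1)) :=
        mul_le_mul_of_nonneg_left (sum_pinched_coeff_le hμ α) hV0
      calc Real.sqrt (V⁻¹ * ∑ i, β i ^ 2 * (μ i + 1))
          ≤ Real.sqrt (V⁻¹ * (ε ^ 2 * ∑ i, α i ^ 2 * (μ i + 1))) := Real.sqrt_le_sqrt h1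
        _ = ε * s₀ := by
            rw [show V⁻¹ * (ε ^ 2 * ∑ i, α i ^ 2 * (μ i + 1)) =
              ε ^ 2 * (V⁻¹ * ∑ i, α i ^ 2 * (μ i + 1)) by ring, Real.sqrt_mul (sq_nonneg ε),
              Real.sqrt_sq hε]
    have ihβ : nβ ≤ ε * X := by
      have h1 : nβ ≤ K * Real.sqrt (V⁻¹ * ∑ i, β i ^ 2 * (μ i + 1)) := ih β
      calc nβ ≤ K * Real.sqrt (V⁻¹ * ∑ i, β i ^ 2 * (μ i + 1)) := h1
        _ ≤ K * (ε * s₀) := mul_le_mul_of_nonneg_left hs₀β hK0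
        _ = ε * X := by ring
    -- the Moser step for `F_α` with `p = νʲ`, `w = F_β`
    have hw := dalembertian_linComb_add_eq h hf hΔ α
    have hwx : ∀ x, (ofRiemannian h).dalembertian (fun z ↦ ∑ i, α i * f i z) x
        + (m : ℝ) * ∑ i, α i * f i x = ∑ i, β i * f i x := fun x ↦ congrFun hw x
    have hstep := aubry_moser_step h hRic hν hA hSob (contMDiff_linComb hf α) hp
    rw [hw] at hstep
    simp only [hwx] at hstep
    -- `hstep : (V⁻¹∫Qα^{pν})^{1/2ν} ≤ A √(p²/(2p-1) · nβ · Tα^{(2p-1)/2p}) + √Tα`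
    -- rewrite everything in terms of `nα`, `nβ`
    have hTα : V⁻¹ * ∫ x, Qα x ^ p ∂riemannianMeasure h = nα ^ (2 * p) := by
      rw [hnαdef, ← Real.rpow_mul hTα0, one_div_mul_cancel (mul_pos two_pos hp0).ne', Real.rpow_one]
    have hTαe : (V⁻¹ * ∫ x, Qα x ^ p ∂riemannianMeasure h) ^ ((2 * p - 1) / (2 * p)) =
        nα ^ (2 * p - 1) := by
      rw [hnαdef, ← Real.rpow_mul hTα0]
      congr 1
      field_simp
    have hsqTα : Real.sqrt (V⁻¹ * ∫ x, Qα x ^ p ∂riemannianMeasure h) = nα ^ p := by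
      rw [Real.sqrt_eq_rpow, hnαdef, ← Real.rpow_mul hTα0]
      congr 1
      field_simp
    have hL : ((V⁻¹ * ∫ x, Qα x ^ (p * ν) ∂riemannianMeasure h) ^ (1 / (2 * ν))) =
        ((V⁻¹ * ∫ x, Qα x ^ (ν ^ (j + 1)) ∂riemannianMeasure h) ^ (1 / (2 * ν ^ (j + 1)))) ^ p := by
      have hpν : p * ν = ν ^ (j + 1) := by rw [hpdef, pow_succ]
      rw [hpν, ← Real.rpow_mul (mul_nonneg hV0 (integral_nonneg fun x ↦
        Real.rpow_nonneg (hQα0 x) _))]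
      congr 1
      rw [hpdef, pow_succ]
      field_simp
    rw [hTαe, hsqTα, hL] at hstep
    -- monotonicity: replace `nβ ≤ εX`, `nα ≤ X`
    have hmono : A * Real.sqrt (p ^ 2 / (2 * p - 1) * nβ * nα ^ (2 * p - 1)) + nα ^ p ≤
        A * Real.sqrt (p ^ 2 / (2 * p - 1) * (ε * X) * X ^ (2 * p - 1)) + X ^ p := by
      have hc0 : 0 ≤ p ^ 2 / (2 * p - 1) := div_nonneg (sq_nonneg _) h2p.le
      have e1 : nα ^ (2 * p - 1) ≤ X ^ (2 * p - 1) := Real.rpow_le_rpow hnα0 ihα h2p.le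
      have e2 : nα ^ p ≤ X ^ p := Real.rpow_le_rpow hnα0 ihα hp0.le
      have e3 : p ^ 2 / (2 * p - 1) * nβ * nα ^ (2 * p - 1) ≤
          p ^ 2 / (2 * p - 1) * (ε * X) * X ^ (2 * p - 1) := by
        have := mul_le_mul ihβ e1 (Real.rpow_nonneg hnα0 _) (mul_nonneg hε hX0)
        calc p ^ 2 / (2 * p - 1) * nβ * nα ^ (2 * p - 1)
            = p ^ 2 / (2 * p - 1) * (nβ * nα ^ (2 * p - 1)) := by ring
          _ ≤ p ^ 2 / (2 * p - 1) * (ε * X * X ^ (2 * p - 1)) :=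
              mul_le_mul_of_nonneg_left this hc0
          _ = p ^ 2 / (2 * p - 1) * (ε * X) * X ^ (2 * p - 1) := by ring
      have e4 := Real.sqrt_le_sqrt e3
      nlinarith [mul_le_mul_of_nonneg_left e4 hA]
    -- evaluate the right-hand side: `= X^p · G`
    have hXpow : X * X ^ (2 * p - 1) = X ^ (2 * p) := by
      conv_rhs => rw [show (2 * p : ℝ) = 1 + (2 * p - 1) by ring, Real.rpow_add' hX0 (by linarith),
        Real.rpow_one]
    have hsqX : Real.sqrt (X ^ (2 * p)) = X ^ p := by
      rw [Real.sqrt_eq_rpow, ← Real.rpow_mul hX0]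
      congr 1
      ring
    have hsqc : Real.sqrt (p ^ 2 / (2 * p - 1)) = p / Real.sqrt (2 * p - 1) := by
      rw [Real.sqrt_div (sq_nonneg p), Real.sqrt_sq hp0.le]
    have hRHS : A * Real.sqrt (p ^ 2 / (2 * p - 1) * (ε * X) * X ^ (2 * p - 1)) + X ^ p =
        X ^ p * G := by
      rw [show p ^ 2 / (2 * p - 1) * (ε * X) * X ^ (2 * p - 1) =
          p ^ 2 / (2 * p - 1) * ε * (X * X ^ (2 * p - 1)) by ring, hXpow,
        Real.sqrt_mul (by positivity), Real.sqrt_mul (div_nonneg (sq_nonneg _) h2p.le),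
        hsqX, hsqc, hGdef]
      ring
    -- conclude: `n'^p ≤ (X G^{1/p})^p`
    set n' := (V⁻¹ * ∫ x, Qα x ^ (ν ^ (j + 1)) ∂riemannianMeasure h) ^ (1 / (2 * ν ^ (j + 1)))
      with hn'def
    have hn'0 : 0 ≤ n' := Real.rpow_nonneg (mul_nonneg hV0 (integral_nonneg fun x ↦
      Real.rpow_nonneg (hQα0 x) _)) _
    have hfin : n' ^ p ≤ (X * G ^ (1 / p)) ^ p := by
      rw [Real.mul_rpow hX0 (Real.rpow_nonneg hG0 _), ← Real.rpow_mul hG0,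
        one_div_mul_cancel hp0.ne', Real.rpow_one, ← hRHS]
      exact hstep.trans hmono
    have hres : n' ≤ X * G ^ (1 / p) :=
      (Real.rpow_le_rpow_iff hn'0 (mul_nonneg hX0 (Real.rpow_nonneg hG0 _)) hp0).1 hfin
    -- and `X G^{1/p} = K_{j+1} s₀`
    rw [Finset.prod_range_succ]
    calc n' ≤ X * G ^ (1 / p) := hres
      _ = K * (1 + A * Real.sqrt ε * (ν ^ j / Real.sqrt (2 * ν ^ j - 1))) ^ ((ν ^ j)⁻¹ : ℝ) * s₀ := by
          rw [hXdef, hGdef, hpdef, one_div]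
          ring

end EigenSpan

/-! ### Part C5 — the `L^∞` endpoint and Lemme 11 (i) -/

section Endpoint

variable {m : ℕ} {H : Type*} [TopologicalSpace H]
  {I : ModelWithCorners ℝ (EuclideanSpace ℝ (Fin m)) H} [I.Boundaryless]
  {N : Type*} [TopologicalSpace N] [ChartedSpace H N] [IsManifold I ∞ N] [CompactSpace N]
  [T2Space N] [MeasurableSpace N] [BorelSpace N]
  (h : ContMDiffRiemannianMetric I ∞ (EuclideanSpace ℝ (Fin m)) (TangentSpace I : N → Type _))

/-- **`‖Q‖_∞ ≤ liminf ‖Q‖_p` on a closed Riemannian manifold**: if a continuous `Q ≥ 0` has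
normalised moments `(⨍ Q^{P_j})^{1/P_j} ≤ B` along exponents `P_j → ∞`, then `Q ≤ B` everywhere
(the Riemannian measure charges the open set `{Q > c}`, `isOpenPosMeasure_riemannianMeasure`).
This is the passage `A_∞ ≤ ∏ⱼ(…)` from the `L^{2νʲ}` bounds in Aubry's proof of Lemme 11 (i).
[cite: Aubry2005, §2, proof of Lemme 11 (i) (p. 394)] -/
theorem le_of_normalized_moments_le {Q : N → ℝ} (hQ : Continuous Q) (hQ0 : ∀ x, 0 ≤ Q x)
    {P : ℕ → ℝ} (hP0 : ∀ j, 0 < P j) (hP : Tendsto P atTop atTop) {B : ℝ}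
    (hle : ∀ j, ((riemannianMeasure h univ).toReal⁻¹ * ∫ x, Q x ^ P j ∂riemannianMeasure h)
      ^ (1 / P j) ≤ B) (x : N) : Q x ≤ B := by
  by_contra hlt
  push Not at hlt
  haveI := isFiniteMeasure_riemannianMeasure h
  haveI := isOpenPosMeasure_riemannianMeasure h
  set c := (B + Q x) / 2 with hcdef
  have hB0 : 0 ≤ B := by
    have h0 := hle 0
    exact le_trans (Real.rpow_nonneg (mul_nonneg (inv_nonneg.2 ENNReal.toReal_nonneg)
      (integral_nonneg fun y ↦ Real.rpow_nonneg (hQ0 y) _)) _) h0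
  have hBc : B < c := by rw [hcdef]; linarith
  have hcQ : c < Q x := by rw [hcdef]; linarith
  have hc0 : 0 < c := lt_of_le_of_lt hB0 hBc
  set U : Set N := {y | c < Q y} with hUdef
  have hUo : IsOpen U := isOpen_lt continuous_const hQ
  have hUne : U.Nonempty := ⟨x, hcQ⟩
  have hμU : 0 < riemannianMeasure h U := hUo.measure_pos _ hUne
  have hμUtop : riemannianMeasure h U < ⊤ := measure_lt_top _ _
  set V := (riemannianMeasure h univ).toReal with hVdef
  have hVpos : 0 < V := by
    refine ENNReal.toReal_pos (ne_of_gt (lt_of_lt_of_le hμU (measure_mono (subset_univ U))))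
      (measure_ne_top _ _)
  have hV0 : 0 ≤ V⁻¹ := inv_nonneg.2 hVpos.le
  set θ := (riemannianMeasure h U).toReal / V with hθdef
  have hθ0 : 0 < θ := div_pos (ENNReal.toReal_pos hμU.ne' hμUtop.ne) hVpos
  -- lower bound for each moment
  have hlow : ∀ j, θ ^ (1 / P j) * c ≤
      ((riemannianMeasure h univ).toReal⁻¹ * ∫ y, Q y ^ P j ∂riemannianMeasure h) ^ (1 / P j) := by
    intro j
    have hI : c ^ P j * (riemannianMeasure h U).toReal ≤ ∫ y, Q y ^ P j ∂riemannianMeasure h := by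
      calc c ^ P j * (riemannianMeasure h U).toReal
          = ∫ y, U.indicator (fun _ ↦ c ^ P j) y ∂riemannianMeasure h := by
            rw [integral_indicator_const _ hUo.measurableSet, smul_eq_mul, measureReal_def, mul_comm]
        _ ≤ ∫ y, Q y ^ P j ∂riemannianMeasure h := by
            refine integral_mono ((integrable_const _).indicator hUo.measurableSet)
              (integrable_of_continuous h (hQ.rpow_const fun y ↦ Or.inr (hP0 j).le)) fun y ↦ ?_
            by_cases hy : y ∈ U
            · rw [indicator_of_mem hy]
              exact Real.rpow_le_rpow hc0.le (le_of_lt hy) (hP0 j).le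
            · rw [indicator_of_notMem hy]
              exact Real.rpow_nonneg (hQ0 y) _
    have h2 : θ * c ^ P j ≤ V⁻¹ * ∫ y, Q y ^ P j ∂riemannianMeasure h := by
      rw [hθdef, div_eq_inv_mul, mul_assoc]
      refine mul_le_mul_of_nonneg_left ?_ hV0
      linarith
    calc θ ^ (1 / P j) * c = (θ * c ^ P j) ^ (1 / P j) := by
          rw [Real.mul_rpow hθ0.le (Real.rpow_nonneg hc0.le _), one_div,
            Real.rpow_rpow_inv hc0.le (hP0 j).ne']
      _ ≤ (V⁻¹ * ∫ y, Q y ^ P j ∂riemannianMeasure h) ^ (1 / P j) :=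
          Real.rpow_le_rpow (mul_nonneg hθ0.le (Real.rpow_nonneg hc0.le _)) h2
            (one_div_nonneg.2 (hP0 j).le)
  -- `θ^{1/P_j} c → c > B`
  have hlim : Tendsto (fun j ↦ θ ^ (1 / P j) * c) atTop (𝓝 (θ ^ (0 : ℝ) * c)) := by
    have h1 : Tendsto (fun j ↦ 1 / P j) atTop (𝓝 0) :=
      Tendsto.congr (fun j ↦ by simp [one_div]) hP.inv_tendsto_atTop
    exact ((Real.continuousAt_const_rpow hθ0.ne').tendsto.comp h1).mul_const c
  rw [Real.rpow_zero, one_mul] at hlim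
  obtain ⟨j, hj⟩ := (hlim.eventually (lt_mem_nhds hBc)).exists
  exact absurd (lt_of_lt_of_le hj (hlow j)) (not_lt.2 (hle j))

variable [(ofRiemannian h).HasLeviCivita] {k : ℕ} {f : Fin k → N → ℝ} {μ : Fin k → ℝ}

/-- **Aubry 2005, Lemme 11 (i)** — the `L^∞` estimate on the span of pinched eigenfunctions,
in function form and PROVED modulo the explicit Sobolev inequality `hSob`:

"Il existe des constantes `α(n) > 0` et `C(n) > 0` telles que si `M` vérifie `λ_k ≤ n + ε` … alors
`‖Σ αᵢ Sᵢ‖_∞ ≤ (1 + C(n)√ε) ‖Σ αᵢ Sᵢ‖₂` pour tout `(αᵢ) ∈ ℝᵏ`" (p. 393).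

Setting: a closed Riemannian `m`-manifold `(N, h)` with `Ric ≥ (m − 1) h`, on which the Sobolev
inequality `‖v‖_{2ν} ≤ A ‖∇v‖₂ + ‖v‖₂` holds for smooth `v` in the normalised norms
`‖v‖_q = ((Vol N)⁻¹ ∫ |v|^q dμ_h)^{1/q}` with some `ν > 1`, `A ≥ 0` (hypothesis `hSob` — Ilias'
inequality [Aubry's ref. 14] with `ν = n/(n−2)`, `A = C(n)` under `Ric ≥ n − 1`, not yet in the
tree); smooth `L²(dμ_h)`-orthonormal `f₁, …, f_k` with `Δ_h fᵢ = −μᵢ fᵢ`, `m ≤ μᵢ ≤ m + ε`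
(`Δ_h = tr_h Hess`). Then for every `α ∈ ℝᵏ` and every point `x`, with `F_α = Σ αᵢ fᵢ` and
`S_α = ∇F_α + F_α e` (so `|S_α|² = |∇F_α|² + F_α²`, `‖S_α‖₂² = (Vol N)⁻¹ Σ αᵢ²(μᵢ+1)`):

  `|S_α(x)|² ≤ exp( 2A√ε / (1 − ν^{−1/2}) ) · ‖S_α‖₂²`,

i.e. `‖S_α‖_∞ ≤ e^{C√ε} ‖S_α‖₂` with `C = A/(1 − ν^{−1/2})` (and `e^{C√ε} ≤ 1 + 2C√ε` for
`C√ε ≤ 1`). Proof: `aubry_moser_iterate` (Moser iteration), `moser_product_le` (log-concavity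
bound of the product) and `le_of_normalized_moments_le` (`L^∞` endpoint).
[cite: Aubry2005, §2, Lemme 11 (i) (pp. 393–394)] -/
theorem aubry_lemma11_i
    (hRic : ∀ (x : N) (v : TangentSpace I x),
      ((m : ℝ) - 1) * h.inner x v v ≤ (ofRiemannian h).ricci x v v)
    {ν A ε : ℝ} (hν : 1 < ν) (hA : 0 ≤ A) (hε : 0 ≤ ε)
    (hSob : ∀ v : N → ℝ, ContMDiff I 𝓘(ℝ, ℝ) ∞ v →
      ((riemannianMeasure h univ).toReal⁻¹ * ∫ x, |v x| ^ (2 * ν) ∂riemannianMeasure h)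
          ^ (1 / (2 * ν)) ≤
        A * Real.sqrt ((riemannianMeasure h univ).toReal⁻¹ *
              ∫ x, (ofRiemannian h).gradSq v x ∂riemannianMeasure h)
          + Real.sqrt ((riemannianMeasure h univ).toReal⁻¹ * ∫ x, v x ^ 2 ∂riemannianMeasure h))
    (hf : ∀ i, ContMDiff I 𝓘(ℝ, ℝ) ∞ (f i))
    (hΔ : ∀ (i : Fin k) (x : N), (ofRiemannian h).dalembertian (f i) x = -(μ i) * f i x)
    (hμ : ∀ i, (m : ℝ) ≤ μ i ∧ μ i ≤ m + ε)
    (horth : ∀ i j, ∫ x, f i x * f j x ∂riemannianMeasure h = if i = j then 1 else 0)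
    (α : Fin k → ℝ) (x : N) :
    (ofRiemannian h).gradSq (fun y ↦ ∑ i, α i * f i y) x + (∑ i, α i * f i x) ^ 2 ≤
      Real.exp (2 * (A * Real.sqrt ε / (1 - (Real.sqrt ν)⁻¹))) *
        ((riemannianMeasure h univ).toReal⁻¹ * ∑ i, α i ^ 2 * (μ i + 1)) := by
  have hg : (ofRiemannian h).IsRiemannian := isRiemannian_ofRiemannian h
  have hν0 : 0 < ν := by linarith
  set V := (riemannianMeasure h univ).toReal with hVdef
  have hV0 : 0 ≤ V⁻¹ := inv_nonneg.2 ENNReal.toReal_nonneg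
  set Q : N → ℝ := fun y ↦ (ofRiemannian h).gradSq (fun z ↦ ∑ i, α i * f i z) y
    + (∑ i, α i * f i y) ^ 2 with hQdef
  have hFs := contMDiff_linComb hf α
  have hQc : Continuous Q := ((contMDiff_gradSq _ hFs).add
    ((contDiff_id.pow 2).comp_contMDiff hFs)).continuous
  have hQ0 : ∀ y, 0 ≤ Q y := fun y ↦ by
    refine add_nonneg ?_ (sq_nonneg _)
    rw [PseudoRiemannianMetric.gradSq, innerDual_eq_val_sharp_sharp]
    exact (ofRiemannian h).val_self_nonneg' y hg _
  set Kinf := Real.exp (A * Real.sqrt ε / (1 - (Real.sqrt ν)⁻¹)) with hKinf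
  set s₀ := Real.sqrt (V⁻¹ * ∑ i, α i ^ 2 * (μ i + 1)) with hs₀
  have hS0 : 0 ≤ V⁻¹ * ∑ i, α i ^ 2 * (μ i + 1) :=
    mul_nonneg hV0 (Finset.sum_nonneg fun i _ ↦ mul_nonneg (sq_nonneg _) (by linarith [(hμ i).1]))
  have hKs : 0 ≤ Kinf * s₀ := mul_nonneg (Real.exp_pos _).le (Real.sqrt_nonneg _)
  -- the uniform `L^{2νʲ}` bounds
  have hmom : ∀ j : ℕ, (V⁻¹ * ∫ y, Q y ^ (ν ^ (j : ℕ)) ∂riemannianMeasure h) ^ (1 / ν ^ (j : ℕ)) ≤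
      (Kinf * s₀) ^ 2 := by
    intro j
    have hit := aubry_moser_iterate h hRic hν hA hε hSob hf hΔ hμ horth j α
    have hpr := moser_product_le hν (mul_nonneg hA (Real.sqrt_nonneg ε)) j
    have hνj : 0 < ν ^ j := pow_pos hν0 j
    have hT0 : 0 ≤ V⁻¹ * ∫ y, Q y ^ (ν ^ (j : ℕ)) ∂riemannianMeasure h :=
      mul_nonneg hV0 (integral_nonneg fun y ↦ Real.rpow_nonneg (hQ0 y) _)
    have hNj : (V⁻¹ * ∫ y, Q y ^ (ν ^ (j : ℕ)) ∂riemannianMeasure h) ^ (1 / (2 * ν ^ (j : ℕ))) ≤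
        Kinf * s₀ := hit.trans (mul_le_mul_of_nonneg_right hpr (Real.sqrt_nonneg _))
    have hsq : (V⁻¹ * ∫ y, Q y ^ (ν ^ (j : ℕ)) ∂riemannianMeasure h) ^ (1 / ν ^ (j : ℕ)) =
        ((V⁻¹ * ∫ y, Q y ^ (ν ^ (j : ℕ)) ∂riemannianMeasure h) ^ (1 / (2 * ν ^ (j : ℕ)))) ^ 2 := by
      have ha : 0 < 1 / (2 * ν ^ j) := one_div_pos.2 (mul_pos two_pos hνj)
      rw [sq, ← Real.rpow_add' hT0 (ne_of_gt (add_pos ha ha))]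
      congr 1
      field_simp
      ring
    rw [hsq]
    exact pow_le_pow_left₀ (Real.rpow_nonneg hT0 _) hNj 2
  have hend := le_of_normalized_moments_le h hQc hQ0 (P := fun j : ℕ ↦ ν ^ (j : ℕ))
    (fun j ↦ pow_pos hν0 j) (tendsto_pow_atTop_atTop_of_one_lt hν) hmom x
  calc (ofRiemannian h).gradSq (fun y ↦ ∑ i, α i * f i y) x + (∑ i, α i * f i x) ^ 2
      = Q x := rfl
    _ ≤ (Kinf * s₀) ^ 2 := hend
    _ = Real.exp (2 * (A * Real.sqrt ε / (1 - (Real.sqrt ν)⁻¹))) *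
          (V⁻¹ * ∑ i, α i ^ 2 * (μ i + 1)) := by
        rw [mul_pow, hs₀, Real.sq_sqrt hS0, hKinf, ← Real.exp_nat_mul]
        push_cast
        ring_nf

end Endpoint

/-! ### Lemme 11 (i) in the vocabulary of the named fact -/

section FactLevel

/-- **Aubry 2005, Lemme 11 (i), in the binders of `aubry_diffeomorph_sphere_of_eigenvalue_pinching`**
(modulo the Sobolev inequality `hSob`). Let `(M, g)` be a closed Riemannian `n`-manifold, `n ≥ 2`,
with `Ric ≥ (n−1) g`, carrying `n` smooth `L²(dv_g)`-orthonormal Laplace eigenfunctions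
`tr_g Hess fᵢ = −μᵢ fᵢ`, `0 < μᵢ ≤ n + ε` (so `n ≤ μᵢ` by Lichnerowicz,
`aubry_eigenfunction_estimates`), and assume the Sobolev inequality
`((Vol M)⁻¹∫|v|^{2ν})^{1/(2ν)} ≤ A ((Vol M)⁻¹∫|∇v|²)^{1/2} + ((Vol M)⁻¹∫v²)^{1/2}` for smooth `v`
(Ilias [14] with `ν = n/(n−2)`, `A = C(n)`). Then for every `α ∈ ℝⁿ` and `x ∈ M`, with
`F_α = Σ αᵢ fᵢ` and `S_α = ∇F_α + F_α e`:

  `|S_α(x)|² = |∇F_α|²(x) + F_α(x)² ≤ e^{2A√ε/(1−ν^{-1/2})} (Vol M)⁻¹ Σ αᵢ²(μᵢ + 1) = e^{2C√ε} ‖S_α‖₂²`.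

[cite: Aubry2005, §2, Lemme 11 (i) (pp. 393–394)] -/
theorem aubry_lemma11_i_of_sobolev (n : ℕ) (hn : 2 ≤ n) {ε : ℝ} (hε : 0 ≤ ε)
    (M : Type*) [TopologicalSpace M] [T2Space M]
    [ChartedSpace (EuclideanSpace ℝ (Fin n)) M] [IsManifold (𝓡 n) ∞ M] [CompactSpace M]
    [MeasurableSpace M] [BorelSpace M]
    (g : Bundle.ContMDiffRiemannianMetric (𝓡 n) ∞ (EuclideanSpace ℝ (Fin n))
      (TangentSpace (𝓡 n) : M → Type _))
    (hLC : (ofRiemannian g).HasLeviCivita) (f : Fin n → M → ℝ) (μ : Fin n → ℝ)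
    (hRic : ∀ (x : M) (v : TangentSpace (𝓡 n) x),
        ((n : ℝ) - 1) * g.inner x v v ≤ (ofRiemannian g).ricci x v v)
    (hf : ∀ i, ContMDiff (𝓡 n) 𝓘(ℝ, ℝ) ∞ (f i))
    (hΔ : ∀ (i : Fin n) (x : M), (ofRiemannian g).dalembertian (f i) x = -(μ i) * f i x)
    (hμ : ∀ i, 0 < μ i ∧ μ i ≤ n + ε)
    (horth : ∀ i j, ∫ x, f i x * f j x ∂(riemannianMeasure g) = if i = j then 1 else 0)
    {ν A : ℝ} (hν : 1 < ν) (hA : 0 ≤ A)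
    (hSob : ∀ v : M → ℝ, ContMDiff (𝓡 n) 𝓘(ℝ, ℝ) ∞ v →
      ((riemannianMeasure g univ).toReal⁻¹ * ∫ x, |v x| ^ (2 * ν) ∂riemannianMeasure g)
          ^ (1 / (2 * ν)) ≤
        A * Real.sqrt ((riemannianMeasure g univ).toReal⁻¹ *
              ∫ x, (ofRiemannian g).gradSq v x ∂riemannianMeasure g)
          + Real.sqrt ((riemannianMeasure g univ).toReal⁻¹ * ∫ x, v x ^ 2 ∂riemannianMeasure g))
    (α : Fin n → ℝ) (x : M) :
    (ofRiemannian g).gradSq (fun y ↦ ∑ i, α i * f i y) x + (∑ i, α i * f i x) ^ 2 ≤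
      Real.exp (2 * (A * Real.sqrt ε / (1 - (Real.sqrt ν)⁻¹))) *
        ((riemannianMeasure g univ).toReal⁻¹ * ∑ i, α i ^ 2 * (μ i + 1)) := by
  haveI := hLC
  -- the two-sided pinching `n ≤ μᵢ ≤ n + ε` (Lichnerowicz)
  have hμ2 : ∀ i, (n : ℝ) ≤ μ i ∧ μ i ≤ n + ε := fun i ↦ by
    have hnorm : ∫ x, f i x * f i x ∂(riemannianMeasure g) = 1 := by
      rw [horth i i, if_pos rfl]
    exact ⟨(aubry_eigenfunction_estimates n hn ε M g hLC (f i) (μ i) hRic (hf i) (hΔ i) (hμ i)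
      hnorm).2.1, (hμ i).2⟩
  exact aubry_lemma11_i g hRic hν hA hε hSob hf hΔ hμ2 horth α x

end FactLevel





/-! ## Part D — Lemme 11 (ii): almost-orthonormality on a set of almost full measure -/

section AlmostOrthonormal

variable {m : ℕ} {H : Type*} [TopologicalSpace H]
  {I : ModelWithCorners ℝ (EuclideanSpace ℝ (Fin m)) H} [I.Boundaryless]
  {N : Type*} [TopologicalSpace N] [ChartedSpace H N] [IsManifold I ∞ N] [CompactSpace N]
  [T2Space N] [MeasurableSpace N] [BorelSpace N]
  (h : ContMDiffRiemannianMetric I ∞ (EuclideanSpace ℝ (Fin m)) (TangentSpace I : N → Type _))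

omit [I.Boundaryless] in
/-- **Chebyshev step of Aubry's Lemme 11 (ii)** (pp. 394–395: "Nous allons maintenant prouver que
l'inégalité (i) implique la propriété (ii)"), abstract form. Let `P i j : N → ℝ` (`i, j < k`) be
continuous and symmetric — the pointwise Gram functions `⟨Sᵢ(x), Sⱼ(x)⟩_E` of a family of
sections — with normalised `L²`-norms `(Vol N)⁻¹ ∫ P i i = 1` and the `L^∞`-bound of Lemme 11 (i)
in the form `Σᵢⱼ αᵢαⱼ P i j (x) ≤ K² Σ αᵢ²` (`K ≥ 1`; i.e. `‖Σαᵢ Sᵢ‖²_∞ ≤ K² ‖Σ αᵢSᵢ‖₂²` for an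
`L²`-orthonormal family). For `η > 0` let
`M_η = {x | ∀ i ≠ j, |Sᵢ ± Sⱼ|²(x) ≥ 2(1 − η), ∀ i, |Sᵢ|²(x) ≥ 1 − η}` (Aubry's set, p. 394). Then
`M_η` is closed, `Vol(N ∖ M_η) ≤ k (K² − 1)/η · Vol N`, and on `M_η`:
`|P i j (x) − δᵢⱼ| ≤ K² − 1 + η` (p. 395: "`|⟨Sᵢ(x), Sⱼ(x)⟩_E| ≤ (2(1 + C√ε) − 2(1 − ε^{1/4}))/4`").
Aubry takes `η = ε^{1/4}` and `K² = (1 + C(n)√ε)²`. [cite: Aubry2005, §2, proof of Lemme 11 (ii) (pp. 394–395)] -/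
theorem aubry_chebyshev_almostOrthonormal {k : ℕ} (P : Fin k → Fin k → N → ℝ)
    (hPc : ∀ i j, Continuous (P i j)) (hPs : ∀ i j x, P i j x = P j i x)
    (hP1 : ∀ i, (riemannianMeasure h univ).toReal⁻¹ * ∫ x, P i i x ∂riemannianMeasure h = 1)
    {K : ℝ} (hK : 1 ≤ K)
    (hPsup : ∀ (α : Fin k → ℝ) (x : N), ∑ i, ∑ j, α i * α j * P i j x ≤ K ^ 2 * ∑ i, α i ^ 2)
    {η : ℝ} (hη : 0 < η) :
    IsClosed {x : N | (∀ i j, i ≠ j → 2 * (1 - η) ≤ P i i x + P j j x - 2 * P i j x ∧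
        2 * (1 - η) ≤ P i i x + P j j x + 2 * P i j x) ∧ ∀ i, 1 - η ≤ P i i x} ∧
      (riemannianMeasure h {x : N | (∀ i j, i ≠ j → 2 * (1 - η) ≤ P i i x + P j j x - 2 * P i j x ∧
        2 * (1 - η) ≤ P i i x + P j j x + 2 * P i j x) ∧ ∀ i, 1 - η ≤ P i i x}ᶜ).toReal ≤
        k * (K ^ 2 - 1) / η * (riemannianMeasure h univ).toReal ∧
      ∀ x ∈ {x : N | (∀ i j, i ≠ j → 2 * (1 - η) ≤ P i i x + P j j x - 2 * P i j x ∧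
        2 * (1 - η) ≤ P i i x + P j j x + 2 * P i j x) ∧ ∀ i, 1 - η ≤ P i i x},
        ∀ i j, |P i j x - (if i = j then 1 else 0)| ≤ K ^ 2 - 1 + η := by
  haveI := isFiniteMeasure_riemannianMeasure h
  set V := (riemannianMeasure h univ).toReal with hVdef
  set Mη : Set N := {x : N | (∀ i j, i ≠ j → 2 * (1 - η) ≤ P i i x + P j j x - 2 * P i j x ∧
        2 * (1 - η) ≤ P i i x + P j j x + 2 * P i j x) ∧ ∀ i, 1 - η ≤ P i i x} with hMη
  -- pointwise consequences of the sup bound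
  have hdiag : ∀ i x, P i i x ≤ K ^ 2 := by
    intro i x
    have h1 := hPsup (fun l ↦ if l = i then 1 else 0) x
    simp only [mul_ite, mul_one, mul_zero, ite_mul, one_mul, zero_mul, Finset.sum_ite_eq',
      Finset.mem_univ, if_true, ite_pow, one_pow, zero_pow two_ne_zero] at h1
    simpa using h1
  have hpm : ∀ i j, i ≠ j → ∀ x, P i i x + P j j x + 2 * P i j x ≤ 2 * K ^ 2 ∧
      P i i x + P j j x - 2 * P i j x ≤ 2 * K ^ 2 := by
    intro i j hij x
    -- `α = eᵢ + s eⱼ`, `s = ±1`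
    have hE : ∀ (g : Fin k → ℝ) (l : Fin k) (c : ℝ),
        ∑ b, (c * (if b = l then (1 : ℝ) else 0)) * g b = c * g l := by
      intro g l c
      simp only [mul_ite, mul_one, mul_zero, ite_mul, zero_mul, Finset.sum_ite_eq',
        Finset.mem_univ, if_true]
    have key : ∀ s : ℝ, s ^ 2 = 1 →
        P i i x + P j j x + 2 * s * P i j x ≤ 2 * K ^ 2 := by
      intro s hs
      set u : Fin k → ℝ := fun b ↦ 1 * (if b = i then (1 : ℝ) else 0) + s * (if b = j then 1 else 0)
        with hu
      have hinner : ∀ g : Fin k → ℝ, ∑ b, u b * g b = 1 * g i + s * g j := by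
        intro g
        simp only [hu, add_mul, Finset.sum_add_distrib, hE]
      have hQ : ∑ a, ∑ b, u a * u b * P a b x = P i i x + s ^ 2 * P j j x + 2 * s * P i j x := by
        have h1 : ∀ a, ∑ b, u a * u b * P a b x = u a * (∑ b, u b * P a b x) := by
          intro a
          rw [Finset.mul_sum]
          refine Finset.sum_congr rfl fun b _ ↦ ?_
          ring
        simp only [h1, hinner]
        rw [hPs j i x]
        ring
      have hui : u i = 1 := by simp [hu, hij]
      have huj : u j = s := by simp [hu, hij.symm]
      have hR : ∑ a, u a ^ 2 = 1 + s ^ 2 := by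
        have h1 : ∀ a, u a ^ 2 = u a * u a := fun a ↦ sq _
        simp only [h1, hinner, hui, huj]
        ring
      have h1 := hPsup u x
      rw [hQ, hR, hs] at h1
      linarith
    refine ⟨by have := key 1 (by norm_num); linarith, by have := key (-1) (by norm_num); linarith⟩
  -- the function `hsum = Σᵢ P i i` and the gap
  set gap := K ^ 2 - 1 + η with hgap
  have hgap0 : 0 < gap := by rw [hgap]; nlinarith
  have hK2 : 1 ≤ K ^ 2 := by nlinarith
  have hbound : ∀ x, ∑ i, P i i x ≤ k * K ^ 2 - gap * (Mηᶜ.indicator (fun _ ↦ (1 : ℝ)) x) := by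
    intro x
    by_cases hx : x ∈ Mη
    · rw [indicator_of_notMem (by simpa using hx), mul_zero, sub_zero]
      calc ∑ i, P i i x ≤ ∑ _i : Fin k, K ^ 2 := Finset.sum_le_sum fun i _ ↦ hdiag i x
        _ = k * K ^ 2 := by simp
    · rw [indicator_of_mem (by simpa using hx), mul_one]
      -- some defining inequality fails at `x`
      simp only [hMη, Set.mem_setOf_eq, not_and_or, not_forall, not_le, exists_prop] at hx
      rcases hx with ⟨i, j, hij, hfail⟩ | ⟨i, hi⟩
      · -- a pair condition fails: then `P i i + P j j < K² + 1 - η`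
        have hij2 : P i i x + P j j x < K ^ 2 + 1 - η := by
          rcases hfail with h1 | h1
          · linarith [(hpm i j hij x).1]
          · linarith [(hpm i j hij x).2]
        have hrest : ∑ l ∈ (Finset.univ.erase i).erase j, P l l x ≤
            ∑ _l ∈ (Finset.univ.erase i).erase j, K ^ 2 :=
          Finset.sum_le_sum fun l _ ↦ hdiag l x
        have hji : j ∈ Finset.univ.erase i := Finset.mem_erase.2 ⟨hij.symm, Finset.mem_univ j⟩
        have hsplit : ∑ l, P l l x = P i i x + (P j j x + ∑ l ∈ (Finset.univ.erase i).erase j, P l l x) := by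
          rw [← Finset.add_sum_erase _ _ (Finset.mem_univ i), ← Finset.add_sum_erase _ _ hji]
        have hcard : (∑ _l ∈ (Finset.univ.erase i).erase j, K ^ 2) = (k - 2 : ℝ) * K ^ 2 := by
          rw [Finset.sum_const, Finset.card_erase_of_mem hji, Finset.card_erase_of_mem (Finset.mem_univ i),
            Finset.card_univ, Fintype.card_fin, nsmul_eq_mul]
          have hk : 2 ≤ k := by
            rcases Nat.lt_or_ge k 2 with hk | hk
            · exfalso
              have : Fintype.card (Fin k) ≤ 1 := by rw [Fintype.card_fin]; omega
              exact hij (Fintype.card_le_one_iff.1 this i j)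
            · exact hk
          push_cast [Nat.sub_sub, Nat.cast_sub hk]
          ring
        rw [hsplit]
        rw [hcard] at hrest
        rw [hgap]
        linarith
      · -- a diagonal condition fails
        have hrest : ∑ l ∈ Finset.univ.erase i, P l l x ≤ ∑ _l ∈ Finset.univ.erase i, K ^ 2 :=
          Finset.sum_le_sum fun l _ ↦ hdiag l x
        have hsplit : ∑ l, P l l x = P i i x + ∑ l ∈ Finset.univ.erase i, P l l x := by
          rw [← Finset.add_sum_erase _ _ (Finset.mem_univ i)]
        have hcard : (∑ _l ∈ Finset.univ.erase i, K ^ 2) = (k - 1 : ℝ) * K ^ 2 := by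
          rw [Finset.sum_const, Finset.card_erase_of_mem (Finset.mem_univ i), Finset.card_univ,
            Fintype.card_fin, nsmul_eq_mul]
          have hk : 1 ≤ k := Nat.one_le_iff_ne_zero.2 (by rintro rfl; exact Fin.elim0 i)
          push_cast [Nat.cast_sub hk]
          ring
        rw [hsplit]
        rw [hcard] at hrest
        rw [hgap]
        linarith
  -- closedness / measurability of `M_η`
  have hclosed : IsClosed Mη := by
    have h1 : IsClosed {x : N | ∀ i j, i ≠ j → 2 * (1 - η) ≤ P i i x + P j j x - 2 * P i j x ∧
        2 * (1 - η) ≤ P i i x + P j j x + 2 * P i j x} := by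
      have : {x : N | ∀ i j, i ≠ j → 2 * (1 - η) ≤ P i i x + P j j x - 2 * P i j x ∧
          2 * (1 - η) ≤ P i i x + P j j x + 2 * P i j x} =
          ⋂ i, ⋂ j, {x : N | i ≠ j → 2 * (1 - η) ≤ P i i x + P j j x - 2 * P i j x ∧
            2 * (1 - η) ≤ P i i x + P j j x + 2 * P i j x} := by
        ext x; simp
      rw [this]
      refine isClosed_iInter fun i ↦ isClosed_iInter fun j ↦ ?_
      by_cases hij : i = j
      · simp [hij]
      · simp only [hij, ne_eq, not_false_eq_true, forall_const]
        exact (isClosed_le continuous_const (((hPc i i).add (hPc j j)).sub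
          (continuous_const.mul (hPc i j)))).inter
          (isClosed_le continuous_const (((hPc i i).add (hPc j j)).add
          (continuous_const.mul (hPc i j))))
    have h2 : IsClosed {x : N | ∀ i, 1 - η ≤ P i i x} := by
      have : {x : N | ∀ i, 1 - η ≤ P i i x} = ⋂ i, {x | 1 - η ≤ P i i x} := by ext x; simp
      rw [this]
      exact isClosed_iInter fun i ↦ isClosed_le continuous_const (hPc i i)
    simpa [hMη, Set.setOf_and] using h1.inter h2
  have hmeas : MeasurableSet Mηᶜ := hclosed.measurableSet.compl
  -- integrate the pointwise bound
  have hint : (k : ℝ) * V ≤ k * K ^ 2 * V - gap * (riemannianMeasure h Mηᶜ).toReal := by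
    have hI1 : ∫ x, ∑ i, P i i x ∂riemannianMeasure h = k * V := by
      rw [integral_finsetSum _ (fun i _ ↦ integrable_of_continuous h (hPc i i))]
      have hV1 : ∀ i, ∫ x, P i i x ∂riemannianMeasure h = V := by
        intro i
        have h1 := hP1 i
        by_cases hV : V = 0
        · -- `V = 0`: then `N` has measure zero and all integrals vanish
          have hμ0 : riemannianMeasure h = 0 := by
            rw [← Measure.measure_univ_eq_zero]
            have := (ENNReal.toReal_eq_zero_iff _).1 (hVdef ▸ hV)
            exact this.resolve_right (measure_ne_top _ _)
          simp [hμ0, hV]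
        · field_simp at h1
          linarith
      simp [hV1]
    have hI2 : ∫ x, ((k : ℝ) * K ^ 2 - gap * Mηᶜ.indicator (fun _ ↦ (1 : ℝ)) x)
        ∂riemannianMeasure h = k * K ^ 2 * V - gap * (riemannianMeasure h Mηᶜ).toReal := by
      rw [integral_sub (integrable_const _) ((integrable_const _).indicator hmeas |>.const_mul _),
        integral_const, integral_const_mul, integral_indicator_const _ hmeas, smul_eq_mul,
        smul_eq_mul, measureReal_def, measureReal_def, mul_one]
      ring
    rw [← hI1, ← hI2]
    exact integral_mono (integrable_finsetSum _ (fun i _ ↦ integrable_of_continuous h (hPc i i)))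
      ((integrable_const _).sub (((integrable_const _).indicator hmeas).const_mul _)) hbound
  refine ⟨hclosed, ?_, ?_⟩
  · -- the measure estimate
    have hV0 : 0 ≤ V := ENNReal.toReal_nonneg
    have h1 : gap * (riemannianMeasure h Mηᶜ).toReal ≤ k * (K ^ 2 - 1) * V := by nlinarith
    have h2 : (riemannianMeasure h Mηᶜ).toReal ≤ k * (K ^ 2 - 1) * V / gap := by
      rw [le_div_iff₀ hgap0]; linarith
    calc (riemannianMeasure h Mηᶜ).toReal ≤ k * (K ^ 2 - 1) * V / gap := h2
      _ ≤ k * (K ^ 2 - 1) * V / η := by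
          refine div_le_div_of_nonneg_left (by positivity) hη (by rw [hgap]; linarith)
      _ = k * (K ^ 2 - 1) / η * V := by ring
  · -- on `M_η`
    intro x hx i j
    simp only [hMη, Set.mem_setOf_eq] at hx
    by_cases hij : i = j
    · subst hij
      rw [if_pos rfl]
      have h1 := hx.2 i
      have h2 := hdiag i x
      rw [abs_le]
      constructor <;> nlinarith
    · rw [if_neg hij, sub_zero, abs_le]
      have h1 := (hx.1 i j hij).1
      have h2 := (hx.1 i j hij).2
      have h3 := (hpm i j hij x).1
      have h4 := (hpm i j hij x).2
      constructor <;> linarith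

end AlmostOrthonormal

section AlmostOrthonormalEigen

variable {m : ℕ} {H : Type*} [TopologicalSpace H]
  {I : ModelWithCorners ℝ (EuclideanSpace ℝ (Fin m)) H} [I.Boundaryless]
  {N : Type*} [TopologicalSpace N] [ChartedSpace H N] [IsManifold I ∞ N] [CompactSpace N]
  [T2Space N] [MeasurableSpace N] [BorelSpace N]
  (h : ContMDiffRiemannianMetric I ∞ (EuclideanSpace ℝ (Fin m)) (TangentSpace I : N → Type _))
  [(ofRiemannian h).HasLeviCivita]
  {k : ℕ} {f : Fin k → N → ℝ} {μ : Fin k → ℝ}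

omit [CompactSpace N] [T2Space N] [MeasurableSpace N] [BorelSpace N] [I.Boundaryless]
  [(ofRiemannian h).HasLeviCivita] in
/-- **`|S_β(x)|²` is the Gram quadratic form**: for `F = Σ βₐ fₐ`,
`|∇F|²(x) + F(x)² = Σₐ Σ_b βₐ β_b (g⁻¹(dfₐ, df_b)(x) + fₐ(x) f_b(x))` — bilinearity of
`⟨S_F, S_F⟩_E` in `F` (Aubry 2005, p. 391). [cite: Aubry2005, §2 (p. 391)] -/
theorem gradSq_add_sq_linComb_eq_sum (hf : ∀ i, ContMDiff I 𝓘(ℝ, ℝ) ∞ (f i)) (β : Fin k → ℝ)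
    (x : N) :
    (ofRiemannian h).gradSq (fun y ↦ ∑ a, β a * f a y) x + (∑ a, β a * f a x) ^ 2 =
      ∑ a, ∑ b, β a * β b *
        ((ofRiemannian h).innerDual x (mvfderiv I (f a) x : TangentSpace I x →ₗ[ℝ] ℝ)
          (mvfderiv I (f b) x : TangentSpace I x →ₗ[ℝ] ℝ) + f a x * f b x) := by
  have hfd : ∀ a, MDifferentiableAt I 𝓘(ℝ, ℝ) (f a) x := fun a ↦ (hf a).mdifferentiableAt (by simp)
  have hcfd : ∀ a, MDifferentiableAt I 𝓘(ℝ, ℝ) (fun y ↦ β a * f a y) x := fun a ↦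
    (mdifferentiableAt_const (c := β a)).mul (hfd a)
  -- `d(Σ βₐ fₐ) = Σ βₐ dfₐ`
  have hd : (mvfderiv I (fun y ↦ ∑ a, β a * f a y) x : TangentSpace I x →ₗ[ℝ] ℝ) =
      ∑ a, β a • (mvfderiv I (f a) x : TangentSpace I x →ₗ[ℝ] ℝ) := by
    have h1 := (mvfderiv_finset_sum (I := I) Finset.univ (F := fun a y ↦ β a * f a y) (p := x)
      (fun a _ ↦ hcfd a)).2
    ext v
    rw [ContinuousLinearMap.coe_coe, h1, _root_.sum_apply, LinearMap.sum_apply]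
    refine Finset.sum_congr rfl fun a _ ↦ ?_
    rw [mvfderiv_fun_mul (mdifferentiableAt_const (c := β a)) (hfd a)]
    simp [mvfderiv_const]
  -- bilinearity of `g⁻¹`
  have hsumL : ∀ (w : Fin k → Module.Dual ℝ (TangentSpace I x)) (γ : Module.Dual ℝ (TangentSpace I x)),
      (ofRiemannian h).innerDual x (∑ a, w a) γ = ∑ a, (ofRiemannian h).innerDual x (w a) γ := by
    intro w γ
    simp only [PseudoRiemannianMetric.innerDual, LinearMap.sum_apply]
  have hQ : (ofRiemannian h).gradSq (fun y ↦ ∑ a, β a * f a y) x =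
      ∑ a, ∑ b, β a * β b * (ofRiemannian h).innerDual x
        (mvfderiv I (f a) x : TangentSpace I x →ₗ[ℝ] ℝ)
        (mvfderiv I (f b) x : TangentSpace I x →ₗ[ℝ] ℝ) := by
    rw [PseudoRiemannianMetric.gradSq, hd, hsumL]
    refine Finset.sum_congr rfl fun a _ ↦ ?_
    rw [innerDual_smul_left, (ofRiemannian h).innerDual_comm x, hsumL, Finset.mul_sum]
    refine Finset.sum_congr rfl fun b _ ↦ ?_
    rw [innerDual_smul_left, (ofRiemannian h).innerDual_comm x]
    ring
  have hF : (∑ a, β a * f a x) ^ 2 = ∑ a, ∑ b, β a * β b * (f a x * f b x) := by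
    rw [sq, Finset.sum_mul_sum]
    refine Finset.sum_congr rfl fun a _ ↦ Finset.sum_congr rfl fun b _ ↦ ?_
    ring
  rw [hQ, hF, ← Finset.sum_add_distrib]
  refine Finset.sum_congr rfl fun a _ ↦ ?_
  rw [← Finset.sum_add_distrib]
  refine Finset.sum_congr rfl fun b _ ↦ ?_
  ring

/-- **Aubry 2005, Lemme 11 (ii)** (modulo the Sobolev inequality `hSob`; p. 393: "Il existe un
sous-ensemble `M_ε` de `M` tel que `Vol M_ε ≥ (1 − C(n)ε^{1/4}) Vol M` et
`|⟨Sᵢ(x), Sⱼ(x)⟩_E − δᵢⱼ| ≤ C(n)ε^{1/4}` pour tout `x ∈ M_ε` et tout couple `(i, j)`"), in the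
language of functions. Setting as in `aubry_lemma11_i` (closed Riemannian `m`-manifold, nonempty,
`Ric ≥ m − 1`, Sobolev inequality with constants `(A, 1)` and exponent `ν > 1`, smooth
`L²(dμ_h)`-orthonormal `f₁, …, f_k` with `Δ_h fᵢ = −μᵢfᵢ`, `m ≤ μᵢ ≤ m + ε`). The sections
`Sᵢ = ∇fᵢ + fᵢe` have `⨍|Sᵢ|² = (μᵢ+1)/Vol` (Part B), so Aubry's `L²`-normalised sections are
`S̃ᵢ = cᵢ Sᵢ`, `cᵢ = √(Vol/(μᵢ+1))`, with pointwise Gram functions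
`⟨S̃ᵢ(x), S̃ⱼ(x)⟩_E = cᵢcⱼ (g⁻¹(dfᵢ, dfⱼ)(x) + fᵢ(x)fⱼ(x))`. Then for every `η > 0` there is a closed
set `M_η ⊆ N` with

  `Vol(N ∖ M_η) ≤ k (e^{2a} − 1)/η · Vol N`  and  `|⟨S̃ᵢ(x), S̃ⱼ(x)⟩_E − δᵢⱼ| ≤ e^{2a} − 1 + η` on `M_η`,

`a = A√ε/(1 − ν^{−1/2})` (so `e^{2a} − 1 ≤ C√ε`; Aubry's choice is `η = ε^{1/4}`). Proof: Lemme 11 (i)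
(`aubry_lemma11_i`) gives `‖Σ αᵢS̃ᵢ‖²_∞ ≤ e^{2a}|α|²`; then `aubry_chebyshev_almostOrthonormal`.
[cite: Aubry2005, §2, Lemme 11 (ii) and its proof (pp. 393–395)] -/
theorem aubry_lemma11_ii [Nonempty N]
    (hRic : ∀ (x : N) (v : TangentSpace I x),
      ((m : ℝ) - 1) * h.inner x v v ≤ (ofRiemannian h).ricci x v v)
    {ν A ε : ℝ} (hν : 1 < ν) (hA : 0 ≤ A) (hε : 0 ≤ ε)
    (hSob : ∀ v : N → ℝ, ContMDiff I 𝓘(ℝ, ℝ) ∞ v →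
      ((riemannianMeasure h univ).toReal⁻¹ * ∫ x, |v x| ^ (2 * ν) ∂riemannianMeasure h)
          ^ (1 / (2 * ν)) ≤
        A * Real.sqrt ((riemannianMeasure h univ).toReal⁻¹ *
              ∫ x, (ofRiemannian h).gradSq v x ∂riemannianMeasure h)
          + Real.sqrt ((riemannianMeasure h univ).toReal⁻¹ * ∫ x, v x ^ 2 ∂riemannianMeasure h))
    (hf : ∀ i, ContMDiff I 𝓘(ℝ, ℝ) ∞ (f i))
    (hΔ : ∀ (i : Fin k) (x : N), (ofRiemannian h).dalembertian (f i) x = -(μ i) * f i x)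
    (hμ : ∀ i, (m : ℝ) ≤ μ i ∧ μ i ≤ m + ε)
    (horth : ∀ i j, ∫ x, f i x * f j x ∂riemannianMeasure h = if i = j then 1 else 0)
    {η : ℝ} (hη : 0 < η) :
    ∃ Mη : Set N, IsClosed Mη ∧
      (riemannianMeasure h Mηᶜ).toReal ≤
        k * (Real.exp (2 * (A * Real.sqrt ε / (1 - (Real.sqrt ν)⁻¹))) - 1) / η *
          (riemannianMeasure h univ).toReal ∧
      ∀ x ∈ Mη, ∀ i j,
        |Real.sqrt ((riemannianMeasure h univ).toReal / (μ i + 1)) *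
            Real.sqrt ((riemannianMeasure h univ).toReal / (μ j + 1)) *
            ((ofRiemannian h).innerDual x (mvfderiv I (f i) x : TangentSpace I x →ₗ[ℝ] ℝ)
              (mvfderiv I (f j) x : TangentSpace I x →ₗ[ℝ] ℝ) + f i x * f j x)
          - (if i = j then 1 else 0)| ≤
          Real.exp (2 * (A * Real.sqrt ε / (1 - (Real.sqrt ν)⁻¹))) - 1 + η := by
  haveI := isFiniteMeasure_riemannianMeasure h
  haveI := isOpenPosMeasure_riemannianMeasure h
  set V := (riemannianMeasure h univ).toReal with hVdef
  have hVpos : 0 < V := ENNReal.toReal_pos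
    (isOpen_univ.measure_pos (riemannianMeasure h) univ_nonempty).ne' (measure_ne_top _ _)
  have hμ1 : ∀ i, 0 < μ i + 1 := fun i ↦ by linarith [(hμ i).1, (Nat.cast_nonneg m : (0 : ℝ) ≤ m)]
  set c : Fin k → ℝ := fun i ↦ Real.sqrt (V / (μ i + 1)) with hc
  have hc2 : ∀ i, c i ^ 2 = V / (μ i + 1) := fun i ↦ Real.sq_sqrt (div_nonneg hVpos.le (hμ1 i).le)
  set a := A * Real.sqrt ε / (1 - (Real.sqrt ν)⁻¹) with ha
  set P : Fin k → Fin k → N → ℝ := fun i j x ↦ c i * c j *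
    ((ofRiemannian h).innerDual x (mvfderiv I (f i) x : TangentSpace I x →ₗ[ℝ] ℝ)
      (mvfderiv I (f j) x : TangentSpace I x →ₗ[ℝ] ℝ) + f i x * f j x) with hP
  -- the hypotheses of the Chebyshev lemma
  have hPc : ∀ i j, Continuous (P i j) := fun i j ↦
    continuous_const.mul ((contMDiff_innerDual _ (hf i) (hf j)).continuous.add
      ((hf i).continuous.mul (hf j).continuous))
  have hPs : ∀ i j x, P i j x = P j i x := fun i j x ↦ by
    simp only [hP]
    rw [(ofRiemannian h).innerDual_comm x, mul_comm (c i) (c j), mul_comm (f i x) (f j x)]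
  have hP1 : ∀ i, V⁻¹ * ∫ x, P i i x ∂riemannianMeasure h = 1 := by
    intro i
    have hI : ∫ x, ((ofRiemannian h).innerDual x (mvfderiv I (f i) x : TangentSpace I x →ₗ[ℝ] ℝ)
        (mvfderiv I (f i) x : TangentSpace I x →ₗ[ℝ] ℝ) + f i x * f i x) ∂riemannianMeasure h =
        μ i + 1 := by
      have h1 := integral_gradSq_eq_of_dalembertian_eq h ((hf i).of_le (WithTop.coe_le_coe.mpr le_top))
        (hΔ i)
      have h2 : ∫ x, f i x ^ 2 ∂riemannianMeasure h = 1 := by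
        rw [← horth i i |>.trans (if_pos rfl)]
        exact integral_congr_ae (Eventually.of_forall fun x ↦ by simp [sq])
      rw [integral_add (integrable_of_continuous h (contMDiff_innerDual _ (hf i) (hf i)).continuous)
        (integrable_of_continuous h (F := fun x ↦ f i x * f i x)
          ((hf i).continuous.mul (hf i).continuous))]
      have h3 : ∫ x, (ofRiemannian h).innerDual x (mvfderiv I (f i) x : TangentSpace I x →ₗ[ℝ] ℝ)
          (mvfderiv I (f i) x : TangentSpace I x →ₗ[ℝ] ℝ) ∂riemannianMeasure h = μ i * 1 := by
        rw [← h2]; exact h1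
      have h4 : ∫ x, f i x * f i x ∂riemannianMeasure h = 1 := by rw [horth i i, if_pos rfl]
      rw [h3, h4, mul_one]
    simp only [hP]
    rw [integral_const_mul, hI, ← sq, hc2 i]
    field_simp [hVpos.ne', (hμ1 i).ne']
  have hK : (1 : ℝ) ≤ Real.exp a := by
    have ha0 : 0 ≤ a := by
      rw [ha]
      refine div_nonneg (mul_nonneg hA (Real.sqrt_nonneg ε)) ?_
      have hsν : 1 < Real.sqrt ν := by
        rw [show (1 : ℝ) = Real.sqrt 1 from Real.sqrt_one.symm]
        exact Real.sqrt_lt_sqrt zero_le_one hν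
      have := inv_lt_one_of_one_lt₀ hsν
      linarith
    exact Real.one_le_exp ha0
  have hPsup : ∀ (α : Fin k → ℝ) (x : N), ∑ i, ∑ j, α i * α j * P i j x ≤
      Real.exp a ^ 2 * ∑ i, α i ^ 2 := by
    intro α x
    have h1 := aubry_lemma11_i h hRic hν hA hε hSob hf hΔ hμ horth (fun i ↦ α i * c i) x
    have h2 := gradSq_add_sq_linComb_eq_sum h hf (fun i ↦ α i * c i) x
    have hsum : ∑ a, ∑ b, α a * c a * (α b * c b) *
        ((ofRiemannian h).innerDual x (mvfderiv I (f a) x : TangentSpace I x →ₗ[ℝ] ℝ)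
          (mvfderiv I (f b) x : TangentSpace I x →ₗ[ℝ] ℝ) + f a x * f b x) =
        ∑ i, ∑ j, α i * α j * P i j x := by
      refine Finset.sum_congr rfl fun a _ ↦ Finset.sum_congr rfl fun b _ ↦ ?_
      simp only [hP]
      ring
    have hnorm : V⁻¹ * ∑ i, (α i * c i) ^ 2 * (μ i + 1) = ∑ i, α i ^ 2 := by
      rw [Finset.mul_sum]
      refine Finset.sum_congr rfl fun i _ ↦ ?_
      rw [mul_pow, hc2 i]
      field_simp [hVpos.ne', (hμ1 i).ne']
    rw [← hsum, ← h2, ← Real.exp_nat_mul]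
    rw [← ha, hnorm] at h1
    push_cast
    exact h1
  obtain ⟨hclosed, hvol, hon⟩ := aubry_chebyshev_almostOrthonormal h P hPc hPs hP1 hK hPsup hη
  have he : Real.exp a ^ 2 = Real.exp (2 * (A * Real.sqrt ε / (1 - (Real.sqrt ν)⁻¹))) := by
    rw [← Real.exp_nat_mul, ha]
    norm_num
  rw [he] at hvol
  simp only [he] at hon
  exact ⟨_, hclosed, hvol, hon⟩

end AlmostOrthonormalEigen

end Literature.Geometry.Riemannian

end
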